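import Literature.Geometry.Lorentzian.GeodesicSpeed
import Literature.Geometry.Lorentzian.PPCurvatureSingularity
import Literature.Geometry.Riemannian.SimpleManifoldBall
import Literature.Geometry.Riemannian.ConjugatePointsExp
import Literature.Geometry.Riemannian.ExpMapGlobalSmooth
import Literature.Geometry.Lorentzian.GaussEquationFrame
import Mathlib.LinearAlgebra.Matrix.ToLinearEquiv
import Literature.Geometry.Lorentzian.CurvatureRegularity
import Literature.Geometry.Lorentzian.MetricDetComparison
import Literature.Geometry.Lorentzian.FlatParallelFrame
import Literature.Analysis.ODE.FlowWithin
import Literature.Geometry.Riemannian.VolumeSphereTheorem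
import Literature.Geometry.Riemannian.VolumeSphereTheoremProofs
import HarnessLib

/-!
# Cheeger–Colding's volume sphere theorem — proofs file III: parallel frames along geodesics

Third sibling proofs file of `Literature/Geometry/Riemannian/VolumeSphereTheorem.lean` (named fact
`CheegerColding1997_thmA110`, Cheeger–Colding 1997, Thm A.1.10). The matrix Jacobi/Riccati layer
of the Bishop–Gromov inequality (§8–§9 of `VolumeSphereTheoremProofs.lean`, Chavel 2006,
Thm III.4.3) is fed by writing Jacobi fields in a PARALLEL ORTHONORMAL FRAME along the geodesic
(Chavel 2006, §III.1, (III.1.3)–(III.1.5): "let `{e₁, …, e_{n-1}}` be a parallel orthonormal frame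
field along `γ` … then the Jacobi equation reads `η'' + R(t) η = 0`"). This file starts the
frame side with the tree's `IsParallelAlongOn` (`Lorentzian/PPCurvatureSingularity.lean`) and
metric compatibility along curves (`hasDerivAt_val_apply_along`, `Lorentzian/GeodesicSpeed.lean`):

§F1. Inner products of parallel fields are constant (`val_apply_eq_of_isParallelAlongOn`), so a
frame which is parallel along `γ` and orthonormal at one parameter is orthonormal at all
parameters (`orthonormal_frame_of_isParallelAlongOn`), and the coefficient `g(V, P)` of a field
`V` against a parallel field `P` has derivative `g(D_t V, P)`
(`hasDerivAt_val_apply_of_isParallelAlongOn`). (O'Neill 1983, Ch. 3, Lemma 3.20; Chavel 2006,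
§III.1.)

§F2. Orthonormal expansion and the Jacobi equation against a parallel field: a family
orthonormal for a bilinear form is linearly independent and, with `card = dim`, every vector is
`∑ B(v, eᵢ) eᵢ` (`linearIndependent_of_bilin_orthonormal`, `eq_sum_bilin_smul_of_orthonormal`);
for the Levi-Civita connection and a Jacobi field `J` (`IsJacobiFieldAlongOn`,
`Riemannian/SimpleManifoldBall.lean`), `(d/dt) g(D_t J, P) = -g(R(J, γ̇)γ̇, P)` against every
parallel `P` (`hasDerivAt_val_covariantDerivAlong_of_isJacobiFieldAlongOn`).

§F3. The Jacobi equation in a parallel orthonormal frame (Chavel 2006, (III.1.3)–(III.1.5) and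
§III.4): coordinates and traces in a `B`-orthonormal basis (`basisMk_repr_eq_bilin`,
`trace_eq_sum_bilin_of_orthonormal`), the symmetry `g(R(a,u)u, b) = g(R(b,u)u, a)`
(`val_curvature_dir_symm`), `∑ᵢ g(R(eᵢ,u)u, eᵢ) = Ric(u,u)` (`sum_val_curvature_eq_ricci`), and
the coefficient system `(d/dt) g(D_t J, eᵢ) = -∑ⱼ g(R(eⱼ,γ̇)γ̇, eᵢ) g(J, eⱼ)`
(`hasDerivAt_val_covariantDerivAlong_frame`) — i.e. `a'' + R(t) a = 0` with `R` symmetric of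
trace `Ric(γ̇,γ̇)`, the input of §8 of `VolumeSphereTheoremProofs.lean`.

§F4. The tangential direction: the velocity of a geodesic is parallel
(`IsGeodesicOn.isParallelAlongOn_velocity` of `Lorentzian/PPCurvatureSingularity.lean`; constant
speed `val_velocity_eq_of_isGeodesicOn_Icc`), and `R(t)` kills it in both slots
(`val_curvature_self_dir`, and `PseudoRiemannianMetric.val_curvature_self_eq_zero` of
`Lorentzian/CurvatureSymmetries.lean` for the second slot), so with `e₀ ∥ γ̇` the system splits
off Chavel's normal `(dim - 1) × (dim - 1)` block.

§F5. Local existence of parallel transport (O'Neill 1983, Ch. 3, Prop. 3.19, inside one chart;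
boundaryless model `𝓘(ℝ, E)`, `cov` locally `C^∞`): along a differentiable curve
`γ : [0, T] → M` in a chart domain with continuous coordinate velocity, every `v₀ ∈ T_{γ 0}M`
extends to a field `W` with `W 0 = v₀`, parallel on `(0, T)`
(`exists_isParallelAlongOn_of_subset_chartSource`): the linear parallel-transport equation
`w' = -Γ(γ, U) w` (`Lorentzian/FlatParallelFrame.lean`: `Γmat`,
`continuousLinearMapAt_covariantDerivAlong_symmL_Γmat`) solved by
`Literature.Analysis.ODE.exists_solution_linear`.

§F6. Parallel transport from any parameter: the solution operator of a linear ODE has a left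
inverse (adjoint equation `K' = -K A`, `(KJ)' = 0`; `exists_solution_linear_leftInverse`), which in
finite dimensions is a right inverse (`comp_eq_id_comm`); hence the value of the parallel field may
be prescribed at any `t₀ ∈ [0, T]` (`isParallelAt_symmL_of_hasDerivAt`,
`exists_isParallelAlongOn_eq_at`) — with §F1 this gives parallel orthonormal frames on `(0, T)`
with prescribed orthonormal value at an interior parameter: §F7,
`exists_parallel_orthonormal_frame_of_transport` and `exists_parallel_orthonormal_frame` (Chavel
2006, §III.1, "a parallel orthonormal frame field along `γ`").

§F8. The matrix Jacobi equation in a parallel orthonormal frame (placed before §F5, general model):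
`hasDerivAt_frameMatrix_of_isJacobiFieldAlongOn` (`A' = A₁`, `A₁' = -R A` for
`A = (g(J_k, e_i))`, `R = (g(R(e_j, γ̇)γ̇, e_i))`), `isSymm_frameMatrix_curvature`,
`trace_frameMatrix_curvature` (`tr R = Ric(γ̇, γ̇)`) — exactly the hypotheses `hA`, `hA'`, `hR`
and the quantity of `hRic` of the matrix Riccati layer, §8 of `VolumeSphereTheoremProofs.lean`.

§F9. Jacobi fields with prescribed initial data (general model; complete Levi-Civita connection):
`jacobiField_geodesicVariation` — the variation field `J(t) = ∂_s|₀ γ_{v+sw}(t)` is a Jacobi field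
on `ℝ` (`IsJacobiFieldAlongOn … univ`) with `J(0) = 0`, `D_t J(0) = w` and differentiable lifts
of `J`, `D_t J` (from `JacobiVariation.lean`, `ConjugatePointsExp.lean`,
`Lorentzian/GaussEquationFrame.lean`) — the input `A(0) = 0`, `A'(0) = (g(w_k, e_i))` of §F8.

§F10. General parameter intervals `[a, b]` (so that `0` can be an interior parameter, as §F8/§F9
and §8 of the first proofs file require): `exists_solution_linear_leftInverse_Icc` (shift),
`exists_isParallelAlongOn_eq_at_Icc`, `exists_parallel_orthonormal_frame_Icc`.

§F11. Along `γ_v` itself (general-model block): `jacobiField_geodesicVariation'` (§F9 transported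
to the curve `maximalGeodesic p v`) and `exists_jacobiFields_frameMatrix_initial` — for a frame
orthonormal at `0`, the Jacobi fields with `J_k(0) = 0`, `D_t J_k(0) = e_k(0)` have frame matrices
`A(0) = 0`, `A'(0) = 1` (hypotheses `hA0`, `hA'0` of §8 of the first proofs file).

§F12. `det A(t) ≠ 0` where `d(exp_p)_{tv}` is injective
(`det_frameMatrix_ne_zero_of_mfderiv_expMap_injective`): `∑ c_k J_k(t) = d(exp_p)_{tv}(t ∑ c_k w_k)`
(`velocity_geodesicVariation_eq_mfderiv_expMap`), so a kernel vector of `A(t)` gives a kernel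
vector of `d(exp_p)_{tv}` — hypothesis `hdet` of §8 of the first proofs file holds up to the first
conjugate point (Chavel 2006, §III.4).

§F13. The normal block (Chavel 2006, (III.1.5) on `γ̇^⊥`): `sum_val_curvature_normal_eq_ricci`
(`tr R_⊥ = Ric(γ̇, γ̇)` for a full orthonormal frame `Option ι` with `f none = γ̇`),
`hasDerivAt_val_covariantDerivAlong_frame_of_expansion` (the coefficient system for a frame that
contains the field, e.g. a frame of `γ̇^⊥` and a normal Jacobi field),
`val_velocity_eq_zero_of_isJacobiFieldAlongOn` (Jacobi fields with normal initial data stay normal: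
`g(J, γ̇) ≡ 0 ≡ g(D_t J, γ̇)`), `eq_sum_normal_of_val_eq_zero` (expansion of a normal vector in
the normal frame).

§F14. `det_frameMatrix_ne_zero_of_mfderiv_expMap_injective_normal` (the `hdet` statement for the
normal block). §F15. ASSEMBLY `normalJacobiTensor_frame`: along `γ_v`, for a full frame
`f(t) : Option ι → T_{γ_v t}M` with `f(t) none = γ̇_v(t)`, normal part parallel on `(a, b) ∋ 0`,
orthonormal on `(a, b)`, `card = dim`: the normal Jacobi tensor matrices `A, A₁, R` satisfy
`A' = A₁`, `A₁' = -R A`, `Rᵀ = R`, `tr R = Ric(γ̇, γ̇)`, `A(0) = 0`, `A₁(0) = 1`, and `det A(t) ≠ 0`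
where `d(exp_p)_{tv}` is injective — the hypotheses of §8 of `VolumeSphereTheoremProofs.lean`
(Chavel 2006, Thm. III.4.3) except the continuity of `R` at `0` and the Ricci lower bound itself.
§F16. `card_mul_le_sum_val_curvature_of_ricci_ge`: a Ricci lower bound `Ric ≥ (dim-1) κ g` gives
`card ι · κ ≤ tr R_⊥(t)` (hypothesis `hRic` of the first proofs file, `κ = ±1`).
§F17. Continuity of the curvature along a curve (hypothesis `hRc`): frame components of
`g(R(·,·)·,·)` are continuous (`continuousAt_val_curvature_localFrame`, from
`Lorentzian/CurvatureRegularity.lean`), frame coefficients of continuous lifts are continuous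
(`continuousAt_repr_trivializationAt_lift`, `eq_sum_repr_smul_localFrame`), hence
`t ↦ g(R(V₁,V₂)V₃, V₄)(t)` is continuous for fields with continuous lifts
(`continuousAt_val_curvature_along`) and the frame curvature matrix `R(t)` of a parallel frame
along a geodesic is continuous (`continuousAt_frameMatrix_curvature`) — for covariant
derivatives locally `C¹` and `C^∞`.
§F18. CLOSING THE LOOP `noConjugate_length_le_pi_frame`: with the frame data of §F15, the Ricci
bound `Ric(γ̇, γ̇) ≥ dim - 1` on `(0, b)` and no conjugate point on `(0, b)` (`d(exp_p)_{tv}`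
injective), §F15–§F17 feed `jacobi_noConjugate_length_le_pi` of `VolumeSphereTheoremProofs.lean`
and give `b ≤ π` (Bonnet–Myers in Chavel's frame form).
§F19. The comparison inequalities along `γ_v` (Chavel Thm. III.4.3, paper (0.2)/(0.5)):
`normalJacobiTensor_frame_hyps` (the full hypothesis bundle incl. `hRc`, `hdet`),
`det_normalJacobiTensor_le_sin_pow` (`Ric ≥ dim-1`: `det A ≤ sin^{dim-1}`, `det A/sin^{dim-1}`
non-increasing on `(0, min(b, π))`) and `det_normalJacobiTensor_le_sinh_pow` (`Ric ≥ -(dim-1)`: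
`det A ≤ sinh^{dim-1}`, `det A/sinh^{dim-1}` non-increasing on `(0, b)`).
§F20. Frames at a point: Householder reflections for a symmetric bilinear form
(`bilin_householder_householder`), an orthonormal family with prescribed unit head
(`exists_bilin_orthonormal_head`), its `Option`-reindexing (`exists_bilin_orthonormal_option`),
and, for a Riemannian `g`, a full `g_x`-orthonormal frame `Option (Fin k) → T_xM` with prescribed
unit head and `card = dim` (`exists_orthonormal_frame_with_head`) — the initial value of the full
frame of §F15 (via `exists_parallel_orthonormal_frame_Icc`).
§F21 (end of file). `eq_of_isParallelAlongOn_of_eq` (parallel fields agreeing at one parameter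
coincide, for a Riemannian `g`, by definiteness) and `exists_fullFrame_along_geodesic` (model
`𝓘(ℝ, E)`, chart-local): the full frame `f` of `normalJacobiTensor_frame` along a unit-speed
geodesic inside a chart — `f(t) none = γ̇(t)`, normal part parallel and the whole frame
orthonormal on `(a, b)`, `card = dim`.
§F22. `noConjugate_length_le_pi_chart`: the chart-local Bonnet–Myers conjugate point bound along
`γ_v` WITHOUT frame hypotheses (unit `v`, `γ_v([a,b])` in the chart at `p`, `Ric(γ̇,γ̇) ≥ dim-1`,
`d(exp_p)_{tv}` injective on `(0,b)` ⇒ `b ≤ π`).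
§F23. `noConjugate_length_le_pi_of_ricci_ge`: the same for a SMOOTH (`∞ ≤ n`) complete Riemannian
metric, with the regularity of the Levi-Civita connection and the `ContMDiffCovariantDerivative`
instances discharged (`isLocallyContMDiff_leviCivita_holds`,
`contMDiffCovariantDerivative_leviCivita_infty`).

## References

* J. Cheeger, T. H. Colding, J. Differential Geom. 46 (1997) 406–480, Thm A.1.10. [CheegerColding1997]
* I. Chavel, *Riemannian geometry: a modern introduction*, 2nd ed., CUP 2006, §III.1. [Chavel2006]
* B. O'Neill, *Semi-Riemannian geometry*, Academic Press 1983, Ch. 3, Lemma 3.20. [ONeill1983]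
-/

noncomputable section

open Bundle Set Filter
open scoped Manifold ContDiff Topology

namespace Literature.Geometry.Riemannian

open Literature.Geometry.Lorentzian

variable {E : Type*} [NormedAddCommGroup E] [NormedSpace ℝ E] {H : Type*} [TopologicalSpace H]
  {I : ModelWithCorners ℝ E H} {M : Type*} [TopologicalSpace M] [ChartedSpace H M]
  [IsManifold I ∞ M] [FiniteDimensional ℝ E] {n : ℕ∞ω}

section ParallelFrames

variable (g : PseudoRiemannianMetric I n E (TangentSpace I : M → Type _))

/-- **Inner products of parallel fields are constant** (metric compatibility along the curve):
if `P, Q` are parallel along `γ` on `[a, b]` for a `g`-compatible connection, then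
`g(P t, Q t) = g(P a, Q a)` for `t ∈ [a, b]`. [cite: ONeill1983, Ch. 3, Lemma 3.20] -/
theorem val_apply_eq_of_isParallelAlongOn [Fact (1 ≤ n)]
    {cov : CovariantDerivative I E (TangentSpace I : M → Type _)} (hcov : g.IsCompatible cov)
    {γ : ℝ → M} {P Q : Π t : ℝ, TangentSpace I (γ t)} {a b : ℝ}
    (hP : IsParallelAlongOn cov γ P (Icc a b)) (hQ : IsParallelAlongOn cov γ Q (Icc a b))
    {t : ℝ} (ht : t ∈ Icc a b) : g.val (γ t) (P t) (Q t) = g.val (γ a) (P a) (Q a) := by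
  set f : ℝ → ℝ := fun t ↦ g.val (γ t) (P t) (Q t) with hf
  have hderiv : ∀ s ∈ Icc a b, HasDerivAt f 0 s := by
    intro s hs
    have h := PseudoRiemannianMetric.hasDerivAt_val_apply_along g hcov (hP s hs).1 (hQ s hs).1
    rw [(hP s hs).2, (hQ s hs).2, map_zero, zero_apply, map_zero,
      zero_add] at h
    exact h
  have hcont : ContinuousOn f (Icc a b) := fun s hs ↦ (hderiv s hs).continuousAt.continuousWithinAt
  exact constant_of_has_deriv_right_zero hcont
    (fun s hs ↦ ((hderiv s (Ico_subset_Icc_self hs)).hasDerivWithinAt)) t ht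

/-- **A parallel frame stays orthonormal**: if the fields `e i`, `i ∈ ι`, are parallel along `γ`
on `[a, b]` and orthonormal at `a` (`g(e i a, e j a) = δᵢⱼ`), they are orthonormal at every
`t ∈ [a, b]`. [cite: Chavel2006, §III.1 (parallel orthonormal frame fields along geodesics)] -/
theorem orthonormal_frame_of_isParallelAlongOn [Fact (1 ≤ n)] {ι : Type*} [DecidableEq ι]
    {cov : CovariantDerivative I E (TangentSpace I : M → Type _)} (hcov : g.IsCompatible cov)
    {γ : ℝ → M} {e : ι → Π t : ℝ, TangentSpace I (γ t)} {a b : ℝ}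
    (he : ∀ i, IsParallelAlongOn cov γ (e i) (Icc a b))
    (hon : ∀ i j, g.val (γ a) (e i a) (e j a) = if i = j then 1 else 0)
    {t : ℝ} (ht : t ∈ Icc a b) (i j : ι) :
    g.val (γ t) (e i t) (e j t) = if i = j then 1 else 0 := by
  rw [val_apply_eq_of_isParallelAlongOn g hcov (he i) (he j) ht, hon]

/-- **Coefficients in a parallel frame differentiate covariantly**: if `P` is parallel along `γ`
on `s ∋ t` and the lift of `V` is differentiable at `t`, then
`(d/dt) g(V, P) (t) = g(D_t V (t), P t)` — the coefficient `g(J, eᵢ)` of a field in a parallel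
orthonormal frame has derivative `g(D_t J, eᵢ)` (the first step of "the Jacobi equation in a
parallel frame reads `η'' + R(t) η = 0`", Chavel 2006, (III.1.3)–(III.1.5)).
[cite: Chavel2006, §III.1, (III.1.3)–(III.1.5)] -/
theorem hasDerivAt_val_apply_of_isParallelAlongOn [Fact (1 ≤ n)]
    {cov : CovariantDerivative I E (TangentSpace I : M → Type _)} (hcov : g.IsCompatible cov)
    {γ : ℝ → M} {V P : Π t : ℝ, TangentSpace I (γ t)} {s : Set ℝ} {t : ℝ}
    (hV : MDifferentiableAt 𝓘(ℝ, ℝ) I.tangent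
      (fun t ↦ (TotalSpace.mk' E (γ t) (V t) : TangentBundle I M)) t)
    (hP : IsParallelAlongOn cov γ P s) (ht : t ∈ s) :
    HasDerivAt (fun t ↦ g.val (γ t) (V t) (P t))
      (g.val (γ t) (covariantDerivAlong cov γ V t) (P t)) t := by
  have h := PseudoRiemannianMetric.hasDerivAt_val_apply_along g hcov hV (hP t ht).1
  rw [(hP t ht).2, map_zero, add_zero] at h
  exact h

end ParallelFrames

/-! ### §F2. Orthonormal expansion and the Jacobi equation against a parallel field -/

section OrthonormalExpansion

variable {V : Type*} [NormedAddCommGroup V] [NormedSpace ℝ V]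

/-- A family which is orthonormal for a bilinear form `B` (`B(eᵢ, eⱼ) = δᵢⱼ`; no definiteness or
symmetry needed) is linearly independent. [folklore] -/
theorem linearIndependent_of_bilin_orthonormal {ι : Type*} [DecidableEq ι] (B : V →L[ℝ] V →L[ℝ] ℝ)
    {e : ι → V} (hon : ∀ i j, B (e i) (e j) = if i = j then 1 else 0) :
    LinearIndependent ℝ e := by
  classical
  rw [linearIndependent_iff']
  intro s c hs j hj
  have h := congrArg (fun v ↦ B v (e j)) hs
  simp only [map_sum, map_smul, FunLike.coe_sum, FunLike.coe_smul,
    Finset.sum_apply, Pi.smul_apply, smul_eq_mul, hon, mul_ite, mul_one, mul_zero,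
    map_zero, zero_apply] at h
  simpa [hj] using h

/-- **Expansion in a `B`-orthonormal basis**: if `e : ι → V` is `B`-orthonormal with
`card ι = dim V`, then every `v` equals `∑ᵢ B(v, eᵢ) eᵢ`. [folklore] -/
theorem eq_sum_bilin_smul_of_orthonormal {ι : Type*} [Fintype ι] [DecidableEq ι]
    [FiniteDimensional ℝ V] (B : V →L[ℝ] V →L[ℝ] ℝ) {e : ι → V}
    (hon : ∀ i j, B (e i) (e j) = if i = j then 1 else 0)
    (hcard : Fintype.card ι = Module.finrank ℝ V) (v : V) : v = ∑ i, B v (e i) • e i := by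
  classical
  have hli := linearIndependent_of_bilin_orthonormal B hon
  have hsp : ⊤ ≤ Submodule.span ℝ (Set.range e) :=
    (hli.span_eq_top_of_card_eq_finrank' hcard).ge
  set b : Module.Basis ι ℝ V := Module.Basis.mk hli hsp with hb
  have hbe : ∀ i, b i = e i := fun i ↦ by rw [hb, Module.Basis.mk_apply]
  -- coefficients of `v` in the basis `b` are `B(v, eᵢ)`
  have hrepr : ∀ j, b.repr v j = B v (e j) := by
    intro j
    conv_rhs => rw [← b.sum_repr v]
    simp only [map_sum, map_smul, FunLike.coe_sum, FunLike.coe_smul,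
      Finset.sum_apply, Pi.smul_apply, smul_eq_mul, hbe, hon, mul_ite, mul_one, mul_zero,
      Finset.sum_ite_eq', Finset.mem_univ, if_true]
  conv_lhs => rw [← b.sum_repr v]
  exact Finset.sum_congr rfl fun i _ ↦ by rw [hrepr, hbe]

end OrthonormalExpansion

section JacobiAgainstParallel

variable (g : PseudoRiemannianMetric I n E (TangentSpace I : M → Type _))

/-- **The Jacobi equation against a parallel field**: for the Levi-Civita connection, if `P` is
parallel along `γ` on `s ∋ t`, `J` satisfies the Jacobi equation on `s` and the lift of `D_t J`
is differentiable at `t`, then `(d/dt) g(D_t J, P) (t) = -g(R(J, γ̇)γ̇, P)(t)`. With §F1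
(`(d/dt) g(J, P) = g(D_t J, P)`) this is the scalar Jacobi equation for the coefficient
`g(J, eᵢ)` in a parallel orthonormal frame (Chavel 2006, (III.1.3)–(III.1.5)).
[cite: Chavel2006, §III.1, (III.1.3)–(III.1.5)] -/
theorem hasDerivAt_val_covariantDerivAlong_of_isJacobiFieldAlongOn [Fact (1 ≤ n)]
    [CompleteSpace E] [g.HasLeviCivita] {γ : ℝ → M} {J P : Π t : ℝ, TangentSpace I (γ t)}
    {s : Set ℝ} {t : ℝ}
    (hJ : IsJacobiFieldAlongOn g γ J s)
    (hDJ : MDifferentiableAt 𝓘(ℝ, ℝ) I.tangent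
      (fun t ↦ (TotalSpace.mk' E (γ t) (covariantDerivAlong g.leviCivita γ J t) :
        TangentBundle I M)) t)
    (hP : IsParallelAlongOn g.leviCivita γ P s) (ht : t ∈ s) :
    HasDerivAt (fun t ↦ g.val (γ t) (covariantDerivAlong g.leviCivita γ J t) (P t))
      (-(g.val (γ t) (g.leviCivita.curvature (γ t) (J t) (velocity I γ t) (velocity I γ t))
        (P t))) t := by
  have hcompat : g.IsCompatible g.leviCivita :=
    (PseudoRiemannianMetric.isLeviCivita_leviCivita_holds (g := g)).2
  have h := hasDerivAt_val_apply_of_isParallelAlongOn g hcompat hDJ hP ht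
  have hjac : covariantDerivAlong g.leviCivita γ
      (fun τ ↦ covariantDerivAlong g.leviCivita γ J τ) t =
      -(g.leviCivita.curvature (γ t) (J t) (velocity I γ t) (velocity I γ t)) :=
    eq_neg_of_add_eq_zero_left (hJ t ht)
  rw [hjac, map_neg, neg_apply] at h
  exact h

end JacobiAgainstParallel

/-! ### §F3. The Jacobi equation in a parallel orthonormal frame: `a'' + R(t) a = 0`,
`R` symmetric with trace `Ric(γ̇, γ̇)` (Chavel 2006, (III.1.3)–(III.1.5), §III.4) -/

section FrameJacobi

variable {V : Type*} [NormedAddCommGroup V] [NormedSpace ℝ V]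

/-- Coordinates in a `B`-orthonormal basis are `B(v, eᵢ)`: for the basis made of a
`B`-orthonormal family `e` with `card ι = dim V`, `repr v i = B(v, eᵢ)`. [folklore] -/
theorem basisMk_repr_eq_bilin {ι : Type*} [Fintype ι] [DecidableEq ι] [FiniteDimensional ℝ V]
    (B : V →L[ℝ] V →L[ℝ] ℝ) {e : ι → V} (hon : ∀ i j, B (e i) (e j) = if i = j then 1 else 0)
    (hcard : Fintype.card ι = Module.finrank ℝ V) (v : V) (i : ι) :
    (Module.Basis.mk (linearIndependent_of_bilin_orthonormal B hon)
      ((linearIndependent_of_bilin_orthonormal B hon).span_eq_top_of_card_eq_finrank' hcard).ge).repr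
        v i = B v (e i) := by
  classical
  set b := Module.Basis.mk (linearIndependent_of_bilin_orthonormal B hon)
      ((linearIndependent_of_bilin_orthonormal B hon).span_eq_top_of_card_eq_finrank' hcard).ge
    with hb
  have hbe : ∀ i, b i = e i := fun i ↦ by rw [hb, Module.Basis.mk_apply]
  conv_rhs => rw [← b.sum_repr v]
  simp only [map_sum, map_smul, FunLike.coe_sum, FunLike.coe_smul,
    Finset.sum_apply, Pi.smul_apply, smul_eq_mul, hbe, hon, mul_ite, mul_one, mul_zero,
    Finset.sum_ite_eq', Finset.mem_univ, if_true]

/-- **Trace in a `B`-orthonormal basis**: `tr T = ∑ᵢ B(T eᵢ, eᵢ)`. [folklore] -/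
theorem trace_eq_sum_bilin_of_orthonormal {ι : Type*} [Fintype ι] [DecidableEq ι]
    [FiniteDimensional ℝ V] (B : V →L[ℝ] V →L[ℝ] ℝ) {e : ι → V}
    (hon : ∀ i j, B (e i) (e j) = if i = j then 1 else 0)
    (hcard : Fintype.card ι = Module.finrank ℝ V) (T : V →ₗ[ℝ] V) :
    LinearMap.trace ℝ V T = ∑ i, B (T (e i)) (e i) := by
  classical
  set b := Module.Basis.mk (linearIndependent_of_bilin_orthonormal B hon)
      ((linearIndependent_of_bilin_orthonormal B hon).span_eq_top_of_card_eq_finrank' hcard).ge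
    with hb
  have hbe : ∀ i, b i = e i := fun i ↦ by rw [hb, Module.Basis.mk_apply]
  rw [LinearMap.trace_eq_matrix_trace ℝ b, Matrix.trace]
  refine Finset.sum_congr rfl fun i _ ↦ ?_
  rw [Matrix.diag_apply, LinearMap.toMatrix_apply, hbe, basisMk_repr_eq_bilin B hon hcard]

variable (g : PseudoRiemannianMetric I n E (TangentSpace I : M → Type _))

/-- **Symmetry of `R(t)`**: `g(R(a, u)u, b) = g(R(b, u)u, a)` for the curvature of a torsion-free
`g`-compatible locally `C¹` covariant derivative (`n ≥ 2`) — pair symmetry, antisymmetry and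
skew-adjointness of the Riemann tensor; with `u = γ̇` and `a, b` frame vectors this is the
symmetry of the matrix `R(t)` of the Jacobi equation in a parallel frame.
[cite: Chavel2006, §III.1, (III.1.5) (self-adjointness of `R(t) = R(γ', ·)γ'`)] -/
theorem val_curvature_dir_symm {cov : CovariantDerivative I E (TangentSpace I : M → Type _)}
    (hc : g.IsCompatible cov) (hreg : cov.IsLocallyContMDiff 1) (ht : cov.torsion = 0)
    (hn : 2 ≤ n) (x : M) (a b u : TangentSpace I x) :
    g.val x (cov.curvature x a u u) b = g.val x (cov.curvature x b u u) a := by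
  rw [PseudoRiemannianMetric.val_curvature_pair_symm hc hreg ht hn x a u u b,
    cov.curvature_antisymm u b a, map_neg, neg_apply,
    PseudoRiemannianMetric.val_curvature_skew hc hreg hn x b u a u, neg_neg]

/-- **The trace of `R(t)` is the Ricci curvature**: for a `g(x)`-orthonormal family `e` with
`card ι = dim`, `∑ᵢ g(R(eᵢ, u)u, eᵢ) = Ric(u, u)` (`CovariantDerivative.ricci`, the trace of
`v ↦ R(v, u)u`). [cite: Chavel2006, §III.4, proof of Thm. III.4.3 (`tr R(t) = Ric(γ', γ')`)] -/
theorem sum_val_curvature_eq_ricci {ι : Type*} [Fintype ι] [DecidableEq ι]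
    (cov : CovariantDerivative I E (TangentSpace I : M → Type _)) (x : M)
    {e : ι → TangentSpace I x} (hon : ∀ i j, g.val x (e i) (e j) = if i = j then 1 else 0)
    (hcard : Fintype.card ι = Module.finrank ℝ E) (u : TangentSpace I x) :
    ∑ i, g.val x (cov.curvature x (e i) u u) (e i) = cov.ricci x u u := by
  have h := trace_eq_sum_bilin_of_orthonormal (V := E) (g.val x) hon hcard
    (cov.ricciAux x u u)
  have h2 : cov.ricci x u u = LinearMap.trace ℝ E (cov.ricciAux x u u) := rfl
  rw [h2, h]
  exact Finset.sum_congr rfl fun i _ ↦ rfl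

/-- **The Jacobi equation in a parallel orthonormal frame** (Chavel 2006, (III.1.3)–(III.1.5)):
let `e : ι → (fields along γ)` be parallel on `s` for the Levi-Civita connection, `g`-orthonormal
at `t ∈ s` with `card ι = dim M`, and let `J` satisfy the Jacobi equation on `s` with the lift of
`D_t J` differentiable at `t`. Then the coefficient velocities `g(D_t J, eᵢ)` satisfy
`(d/dt) g(D_t J, eᵢ) (t) = -∑ⱼ g(R(eⱼ, γ̇)γ̇, eᵢ)(t) · g(J, eⱼ)(t)`; together with §F1
(`(d/dt) g(J, eᵢ) = g(D_t J, eᵢ)`) this is `a'' + R(t) a = 0` for `aᵢ = g(J, eᵢ)`, with `R(t)`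
symmetric (`val_curvature_dir_symm`) of trace `Ric(γ̇, γ̇)` (`sum_val_curvature_eq_ricci`) — the
input of the matrix Riccati layer, §8 of `VolumeSphereTheoremProofs.lean`.
[cite: Chavel2006, §III.1, (III.1.3)–(III.1.5)] -/
theorem hasDerivAt_val_covariantDerivAlong_frame [Fact (1 ≤ n)] [CompleteSpace E]
    [g.HasLeviCivita] {ι : Type*} [Fintype ι] [DecidableEq ι] {γ : ℝ → M}
    {J : Π t : ℝ, TangentSpace I (γ t)} {e : ι → Π t : ℝ, TangentSpace I (γ t)} {s : Set ℝ}
    {t : ℝ} (hJ : IsJacobiFieldAlongOn g γ J s)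
    (hDJ : MDifferentiableAt 𝓘(ℝ, ℝ) I.tangent
      (fun t ↦ (TotalSpace.mk' E (γ t) (covariantDerivAlong g.leviCivita γ J t) :
        TangentBundle I M)) t)
    (he : ∀ i, IsParallelAlongOn g.leviCivita γ (e i) s) (ht : t ∈ s)
    (hon : ∀ i j, g.val (γ t) (e i t) (e j t) = if i = j then 1 else 0)
    (hcard : Fintype.card ι = Module.finrank ℝ E) (i : ι) :
    HasDerivAt (fun t ↦ g.val (γ t) (covariantDerivAlong g.leviCivita γ J t) (e i t))
      (-∑ j, g.val (γ t) (g.leviCivita.curvature (γ t) (e j t) (velocity I γ t) (velocity I γ t))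
        (e i t) * g.val (γ t) (J t) (e j t)) t := by
  have h := hasDerivAt_val_covariantDerivAlong_of_isJacobiFieldAlongOn g hJ hDJ (he i) ht
  -- expand `J t` in the orthonormal basis `e · t`
  have hexp : J t = ∑ j, g.val (γ t) (J t) (e j t) • e j t :=
    eq_sum_bilin_smul_of_orthonormal (V := E) (g.val (γ t)) hon hcard (J t)
  have hR : g.val (γ t) (g.leviCivita.curvature (γ t) (J t) (velocity I γ t) (velocity I γ t))
      (e i t) = ∑ j, g.val (γ t) (g.leviCivita.curvature (γ t) (e j t) (velocity I γ t)
        (velocity I γ t)) (e i t) * g.val (γ t) (J t) (e j t) := by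
    conv_lhs => rw [hexp]
    simp only [map_sum, map_smul, FunLike.coe_sum, FunLike.coe_smul, Finset.sum_apply,
      Pi.smul_apply, smul_eq_mul]
    exact Finset.sum_congr rfl fun j _ ↦ by ring
  rw [hR] at h
  exact h

end FrameJacobi

/-! ### §F4. The tangential direction: `γ̇` is parallel, and `R(t)` kills it

That the velocity of a geodesic is parallel along it is
`IsGeodesicOn.isParallelAlongOn_velocity` (`Lorentzian/PPCurvatureSingularity.lean`). -/

section Tangential

variable (g : PseudoRiemannianMetric I n E (TangentSpace I : M → Type _))

omit [FiniteDimensional ℝ E] in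
/-- **`R(t)` kills the tangential direction, first slot**: `g(R(u, u)u, b) = 0` (antisymmetry of
the curvature in its first two slots) — in a parallel orthonormal frame with `e₀ ∥ γ̇` the `0`-th
column of `R(t)` vanishes. [cite: Chavel2006, §III.1 (reduction of the Jacobi equation to the normal bundle)] -/
theorem val_curvature_self_dir (cov : CovariantDerivative I E (TangentSpace I : M → Type _))
    (x : M) (u b : TangentSpace I x) : g.val x (cov.curvature x u u u) b = 0 := by
  have h := cov.curvature_antisymm u u u
  have h2 : cov.curvature x u u u = 0 := by
    have : (2:ℝ) • cov.curvature x u u u = 0 := by rw [two_smul]; nth_rw 1 [h]; exact neg_add_cancel _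
    exact (smul_eq_zero.1 this).resolve_left (by norm_num)
  rw [h2, map_zero, zero_apply]

-- The second slot, `g(R(a, u)u, u) = 0` (the `0`-th row of `R(t)` vanishes; skew-adjointness of
-- the curvature of a `g`-compatible locally `C¹` connection, `n ≥ 2`), is
-- `PseudoRiemannianMetric.val_curvature_self_eq_zero` (`Lorentzian/CurvatureSymmetries.lean`).

/-- **Constant speed**: along a geodesic of a `g`-compatible connection `g(γ̇, γ̇)` is constant on
`[a, b]` (§F1 applied to `P = Q = γ̇`; compare `val_velocity_eq_of_isGeodesicOn_of_isCompatible`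
of `Lorentzian/GeodesicSpeed.lean`). [cite: ONeill1983, Ch. 3, Lemma 3.20] -/
theorem val_velocity_eq_of_isGeodesicOn_Icc [Fact (1 ≤ n)]
    {cov : CovariantDerivative I E (TangentSpace I : M → Type _)} (hcov : g.IsCompatible cov)
    {γ : ℝ → M} {a b : ℝ} (h : IsGeodesicOn cov γ (Icc a b)) {t : ℝ} (ht : t ∈ Icc a b) :
    g.val (γ t) (velocity I γ t) (velocity I γ t) = g.val (γ a) (velocity I γ a) (velocity I γ a) :=
  val_apply_eq_of_isParallelAlongOn g hcov (IsGeodesicOn.isParallelAlongOn_velocity h)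
    (IsGeodesicOn.isParallelAlongOn_velocity h) ht

end Tangential


/-! ### §F8. The matrix Jacobi equation `A'' + R A = 0` in a parallel orthonormal frame -/

section MatrixJacobi

variable (g : PseudoRiemannianMetric I n E (TangentSpace I : M → Type _))

/-- **The matrix Jacobi equation in a parallel orthonormal frame** (Chavel 2006, (III.1.5) and
§III.4, the set-up of Thm. III.4.3): for the Levi-Civita connection, a frame `e` parallel on `s`
and `g`-orthonormal on `s` with `card ι = dim M`, and Jacobi fields `J_k` on `s` whose lifts and
whose covariant derivatives' lifts are differentiable on `s`, the matrices
`A(t) = (g(J_k, e_i))`, `A₁(t) = (g(D_t J_k, e_i))`, `R(t) = (g(R(e_j, γ̇)γ̇, e_i))` satisfy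
`A' = A₁` and `A₁' = -R A` at every `t ∈ s` — the hypotheses `hA`, `hA'` of the matrix Riccati
layer (§8 of `VolumeSphereTheoremProofs.lean`). [cite: Chavel2006, §III.1, (III.1.5); §III.4, Thm. III.4.3] -/
theorem hasDerivAt_frameMatrix_of_isJacobiFieldAlongOn [Fact (1 ≤ n)] [CompleteSpace E]
    [g.HasLeviCivita] {ι : Type*} [Fintype ι] [DecidableEq ι] {γ : ℝ → M} {s : Set ℝ}
    {e : ι → Π t : ℝ, TangentSpace I (γ t)} (he : ∀ i, IsParallelAlongOn g.leviCivita γ (e i) s)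
    (hon : ∀ t ∈ s, ∀ i j, g.val (γ t) (e i t) (e j t) = if i = j then 1 else 0)
    (hcard : Fintype.card ι = Module.finrank ℝ E)
    {J : ι → Π t : ℝ, TangentSpace I (γ t)} (hJ : ∀ k, IsJacobiFieldAlongOn g γ (J k) s)
    (hJd : ∀ k, ∀ t ∈ s, MDifferentiableAt 𝓘(ℝ, ℝ) I.tangent
      (fun t ↦ (TotalSpace.mk' E (γ t) (J k t) : TangentBundle I M)) t)
    (hDJd : ∀ k, ∀ t ∈ s, MDifferentiableAt 𝓘(ℝ, ℝ) I.tangent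
      (fun t ↦ (TotalSpace.mk' E (γ t) (covariantDerivAlong g.leviCivita γ (J k) t) :
        TangentBundle I M)) t) {t : ℝ} (ht : t ∈ s) :
    HasDerivAt (fun t ↦ Matrix.of fun i k ↦ g.val (γ t) (J k t) (e i t))
        (Matrix.of fun i k ↦ g.val (γ t) (covariantDerivAlong g.leviCivita γ (J k) t) (e i t)) t ∧
      HasDerivAt (fun t ↦ Matrix.of fun i k ↦
          g.val (γ t) (covariantDerivAlong g.leviCivita γ (J k) t) (e i t))
        (-((Matrix.of fun i j ↦ g.val (γ t) (g.leviCivita.curvature (γ t) (e j t)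
            (velocity I γ t) (velocity I γ t)) (e i t)) *
          Matrix.of fun i k ↦ g.val (γ t) (J k t) (e i t))) t := by
  have hcompat : g.IsCompatible g.leviCivita :=
    (PseudoRiemannianMetric.isLeviCivita_leviCivita_holds (g := g)).2
  refine ⟨?_, ?_⟩
  · refine hasDerivAt_pi.2 fun i ↦ hasDerivAt_pi.2 fun k ↦ ?_
    simp only [Matrix.of_apply]
    exact hasDerivAt_val_apply_of_isParallelAlongOn g hcompat (hJd k t ht) (he i) ht
  · refine hasDerivAt_pi.2 fun i ↦ hasDerivAt_pi.2 fun k ↦ ?_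
    simp only [Matrix.of_apply, Matrix.neg_apply, Matrix.mul_apply]
    exact hasDerivAt_val_covariantDerivAlong_frame g (hJ k) (hDJd k t ht) he ht (hon t ht) hcard i

/-- **`R(t)` is symmetric**: the frame curvature matrix `R(t) = (g(R(e_j, γ̇)γ̇, e_i))` of a
torsion-free `g`-compatible locally `C¹` covariant derivative (`n ≥ 2`) is symmetric
(`val_curvature_dir_symm`) — hypothesis `hR` of §8 of `VolumeSphereTheoremProofs.lean`.
[cite: Chavel2006, §III.1, (III.1.5)] -/
theorem isSymm_frameMatrix_curvature {ι : Type*} [Fintype ι]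
    {cov : CovariantDerivative I E (TangentSpace I : M → Type _)} (hc : g.IsCompatible cov)
    (hreg : cov.IsLocallyContMDiff 1) (htor : cov.torsion = 0) (hn : 2 ≤ n) {γ : ℝ → M}
    (e : ι → Π t : ℝ, TangentSpace I (γ t)) (t : ℝ) :
    (Matrix.of fun i j ↦ g.val (γ t) (cov.curvature (γ t) (e j t) (velocity I γ t)
      (velocity I γ t)) (e i t)).IsSymm := by
  ext i j
  simp only [Matrix.transpose_apply, Matrix.of_apply]
  exact val_curvature_dir_symm g hc hreg htor hn (γ t) (e i t) (e j t) (velocity I γ t)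

/-- **`tr R(t) = Ric(γ̇, γ̇)`** for the frame curvature matrix of an orthonormal frame with
`card ι = dim M` (`sum_val_curvature_eq_ricci`) — the quantity bounded below in hypothesis
`hRic` of §8 of `VolumeSphereTheoremProofs.lean`. [cite: Chavel2006, §III.4, proof of Thm. III.4.3] -/
theorem trace_frameMatrix_curvature {ι : Type*} [Fintype ι] [DecidableEq ι]
    (cov : CovariantDerivative I E (TangentSpace I : M → Type _)) {γ : ℝ → M}
    {e : ι → Π t : ℝ, TangentSpace I (γ t)} {t : ℝ}
    (hon : ∀ i j, g.val (γ t) (e i t) (e j t) = if i = j then 1 else 0)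
    (hcard : Fintype.card ι = Module.finrank ℝ E) :
    (Matrix.of fun i j ↦ g.val (γ t) (cov.curvature (γ t) (e j t) (velocity I γ t)
      (velocity I γ t)) (e i t)).trace = cov.ricci (γ t) (velocity I γ t) (velocity I γ t) := by
  simp only [Matrix.trace, Matrix.diag_apply, Matrix.of_apply]
  exact sum_val_curvature_eq_ricci g cov (γ t) hon hcard (velocity I γ t)

end MatrixJacobi

/-! ### §F9. Jacobi fields with prescribed initial data `J(0) = 0`, `D_t J(0) = w` -/

section JacobiInitialData

open Function

variable [CompleteSpace E] [T2Space M] [I.Boundaryless] [Fact (1 ≤ n)]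
  (g : PseudoRiemannianMetric I n E (TangentSpace I : M → Type _)) [g.HasLeviCivita]
  [CovariantDerivative.ContMDiffCovariantDerivative g.leviCivita 1]
  [CovariantDerivative.ContMDiffCovariantDerivative g.leviCivita ∞]

/-- **The Jacobi field of the geodesic variation** (PSU 2023, Prop. 3.7.10; Lee 2018, Prop. 10.10;
Chavel 2006, §III.1–III.2, the Jacobi fields `Y` with `Y(0) = 0`, `∇_t Y(0) = w` describing
`d(exp_p)`): for a complete Levi-Civita connection, locally `C¹`, the variation field
`J(t) = ∂_s|_{s=0} γ_{v+sw}(t)` along the geodesic `γ_v` is a Jacobi field on all of `ℝ`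
(`IsJacobiFieldAlongOn`), with `J(0) = 0`, `D_t J(0) = w`, and with differentiable lifts of `J`
and of `D_t J` everywhere — the input of the matrix Jacobi equation in a parallel frame (§F8).
[cite: Chavel2006, §III.2 (Jacobi fields and the differential of `exp`)] -/
theorem jacobiField_geodesicVariation (hcov₁ : g.leviCivita.IsLocallyContMDiff 1)
    (hc : IsGeodesicallyComplete g.leviCivita) (p : M) (v w : TangentSpace I p) :
    IsJacobiFieldAlongOn g (fun t ↦ maximalGeodesic g.leviCivita p (v + (0 : ℝ) • w) t)
        (fun t ↦ velocity I (fun s' : ℝ ↦ maximalGeodesic g.leviCivita p (v + s' • w) t) 0) univ ∧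
      velocity I (fun s' : ℝ ↦ maximalGeodesic g.leviCivita p (v + s' • w) 0) 0 = 0 ∧
      covariantDerivAlong g.leviCivita (fun t ↦ maximalGeodesic g.leviCivita p (v + (0 : ℝ) • w) t)
        (fun t ↦ velocity I (fun s' : ℝ ↦ maximalGeodesic g.leviCivita p (v + s' • w) t) 0) 0 = w ∧
      (∀ t, MDifferentiableAt 𝓘(ℝ, ℝ) I.tangent (fun t ↦ (TotalSpace.mk' E
        (maximalGeodesic g.leviCivita p (v + (0 : ℝ) • w) t)
        (velocity I (fun s' : ℝ ↦ maximalGeodesic g.leviCivita p (v + s' • w) t) 0) :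
          TangentBundle I M)) t) ∧
      ∀ t, MDifferentiableAt 𝓘(ℝ, ℝ) I.tangent (fun t ↦ (TotalSpace.mk' E
        (maximalGeodesic g.leviCivita p (v + (0 : ℝ) • w) t)
        (covariantDerivAlong g.leviCivita (fun t ↦ maximalGeodesic g.leviCivita p (v + (0 : ℝ) • w) t)
          (fun t ↦ velocity I (fun s' : ℝ ↦ maximalGeodesic g.leviCivita p (v + s' • w) t) 0) t) :
          TangentBundle I M)) t := by
  have htors : g.leviCivita.torsion = 0 :=
    (PseudoRiemannianMetric.isLeviCivita_leviCivita_holds (g := g)).1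
  have h2 : (2 : ℕ∞ω) ≤ ∞ := WithTop.coe_le_coe.2 le_top
  set X : ℝ → ℝ → M := fun t s ↦ maximalGeodesic g.leviCivita p (v + s • w) t with hX_def
  have hXs : ContMDiff (𝓘(ℝ, ℝ).prod 𝓘(ℝ, ℝ)) I ∞ (uncurry X) :=
    contMDiff_uncurry_geodesicVariation hc p v w
  have hX2 : ∀ q : ℝ × ℝ, ContMDiffAt (𝓘(ℝ, ℝ).prod 𝓘(ℝ, ℝ)) I 2 (uncurry X) q :=
    fun q ↦ (hXs q).of_le h2
  set γ : ℝ → M := fun t ↦ X t 0 with hγ_def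
  set S : Π t : ℝ, TangentSpace I (γ t) := fun t ↦ velocity I (X t) 0 with hS_def
  -- the Jacobi equation
  have hjac : ∀ t₀ : ℝ, covariantDerivAlong g.leviCivita γ
      (fun t ↦ covariantDerivAlong g.leviCivita γ S t) t₀ +
      g.leviCivita.curvature (γ t₀) (S t₀) (velocity I γ t₀) (velocity I γ t₀) = 0 :=
    fun t₀ ↦ jacobi_geodesicVariation hcov₁ htors hc p v w 0 t₀
  -- differentiability of the lifts of `S` and `D_t S`
  have hSl : ContMDiff 𝓘(ℝ, ℝ) I.tangent ∞
      (fun t ↦ (TotalSpace.mk' E (γ t) (S t) : TangentBundle I M)) :=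
    contMDiff_lift_velocity_geodesicVariation hc p v w 0
  have hS : ∀ t, MDifferentiableAt 𝓘(ℝ, ℝ) I.tangent
      (fun t ↦ (TotalSpace.mk' E (γ t) (S t) : TangentBundle I M)) t :=
    fun t ↦ (hSl t).mdifferentiableAt (by simp)
  have hT2 : ∀ q : ℝ × ℝ, ContMDiffAt (𝓘(ℝ, ℝ).prod 𝓘(ℝ, ℝ)) I.tangent 2
      (fun q : ℝ × ℝ ↦ (TotalSpace.mk' E (X q.1 q.2) (velocity I (fun t' ↦ X t' q.2) q.1) :
        TangentBundle I M)) q :=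
    fun q ↦ ((contMDiff_tangentLift_geodesicVariation hc p v w) q).of_le h2
  have hsymm : ∀ t, covariantDerivAlong g.leviCivita γ S t =
      covariantDerivAlong g.leviCivita (X t) (fun s ↦ velocity I (fun t' ↦ X t' s) t) 0 :=
    fun t ↦ covariantDerivAlong_velocity_comm g.leviCivita htors (hX2 (t, 0))
  have hDsT : ∀ t, MDifferentiableAt 𝓘(ℝ, ℝ) I.tangent (fun t' ↦ (TotalSpace.mk' E (X t' 0)
      (covariantDerivAlong g.leviCivita (X t') (fun s ↦ velocity I (fun t'' ↦ X t'' s) t') 0) :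
        TangentBundle I M)) t :=
    fun t ↦ mdifferentiableAt_lift_covariantDerivAlong_curry_right g.leviCivita hcov₁
      (hX2 (t, 0)) (hT2 (t, 0))
  have hDS : ∀ t, MDifferentiableAt 𝓘(ℝ, ℝ) I.tangent
      (fun t' ↦ (TotalSpace.mk' E (γ t') (covariantDerivAlong g.leviCivita γ S t') :
        TangentBundle I M)) t := by
    intro t
    have heq : (fun t' ↦ (TotalSpace.mk' E (γ t') (covariantDerivAlong g.leviCivita γ S t') :
        TangentBundle I M)) =
        fun t' ↦ (TotalSpace.mk' E (X t' 0) (covariantDerivAlong g.leviCivita (X t')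
          (fun s ↦ velocity I (fun t'' ↦ X t'' s) t') 0) : TangentBundle I M) := by
      funext t'
      show (TotalSpace.mk' E (X t' 0) (covariantDerivAlong g.leviCivita γ S t') :
          TangentBundle I M) = _
      rw [TotalSpace.mk_inj]
      exact hsymm t'
    rw [heq]
    exact hDsT t
  refine ⟨fun t _ ↦ hjac t, velocity_geodesicVariation_zero hc p v w 0,
    covariantDerivAlong_velocity_geodesicVariation_zero htors hc p v w, hS, hDS⟩

end JacobiInitialData

/-! ### §F11. Jacobi fields along `γ_v` and the initial data `A(0) = 0`, `A'(0) = 1` -/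

section JacobiInitialData'

variable [CompleteSpace E] [T2Space M] [I.Boundaryless] [Fact (1 ≤ n)]
  (g : PseudoRiemannianMetric I n E (TangentSpace I : M → Type _)) [g.HasLeviCivita]
  [CovariantDerivative.ContMDiffCovariantDerivative g.leviCivita 1]
  [CovariantDerivative.ContMDiffCovariantDerivative g.leviCivita ∞]

/-- §F9 restated along the geodesic `γ_v = maximalGeodesic p v` itself (the curve of
`jacobiField_geodesicVariation` is `t ↦ γ_{v + 0·w}(t)`, equal to `γ_v`): the variation fields for
all `w` are Jacobi fields along the SAME curve, as needed to assemble the matrix `A = (g(J_k, e_i))`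
of §F8 from `w = w_k`. [cite: Chavel2006, §III.2] -/
theorem jacobiField_geodesicVariation' (hcov₁ : g.leviCivita.IsLocallyContMDiff 1)
    (hc : IsGeodesicallyComplete g.leviCivita) (p : M) (v w : TangentSpace I p) :
    ∃ J : Π t : ℝ, TangentSpace I (maximalGeodesic g.leviCivita p v t),
      IsJacobiFieldAlongOn g (maximalGeodesic g.leviCivita p v) J univ ∧ J 0 = 0 ∧
      covariantDerivAlong g.leviCivita (maximalGeodesic g.leviCivita p v) J 0 = w ∧
      (∀ t, MDifferentiableAt 𝓘(ℝ, ℝ) I.tangent (fun t ↦ (TotalSpace.mk' E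
        (maximalGeodesic g.leviCivita p v t) (J t) : TangentBundle I M)) t) ∧
      ∀ t, MDifferentiableAt 𝓘(ℝ, ℝ) I.tangent (fun t ↦ (TotalSpace.mk' E
        (maximalGeodesic g.leviCivita p v t)
        (covariantDerivAlong g.leviCivita (maximalGeodesic g.leviCivita p v) J t) :
          TangentBundle I M)) t := by
  have h := jacobiField_geodesicVariation g hcov₁ hc p v w
  have hv : v + (0 : ℝ) • w = v := by rw [zero_smul, add_zero]
  rw [hv] at h
  exact ⟨_, h.1, h.2.1, h.2.2.1, h.2.2.2.1, h.2.2.2.2⟩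

/-- **Initial data of the frame matrices** (Chavel 2006, §III.4, set-up of Thm. III.4.3: the
Jacobi tensor `A` with `A(0) = 0`, `A'(0) = I`): along `γ_v`, for a frame `e` which is
`g`-orthonormal at the parameter `0`, the Jacobi fields `J_k` with `J_k(0) = 0`,
`D_t J_k(0) = e_k(0)` (`jacobiField_geodesicVariation'`) have frame matrices
`A(0) = (g(J_k, e_i))(0) = 0` and `A'(0) = (g(D_t J_k, e_i))(0) = 1` — hypotheses `hA0`, `hA'0`
of §8 of `VolumeSphereTheoremProofs.lean` (with `hA`, `hA'` from §F8).
[cite: Chavel2006, §III.4, Thm. III.4.3 (set-up)] -/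
theorem exists_jacobiFields_frameMatrix_initial (hcov₁ : g.leviCivita.IsLocallyContMDiff 1)
    (hc : IsGeodesicallyComplete g.leviCivita) (p : M) (v : TangentSpace I p)
    {ι : Type*} [Fintype ι] [DecidableEq ι]
    (e : ι → Π t : ℝ, TangentSpace I (maximalGeodesic g.leviCivita p v t))
    (hon : ∀ i j, g.val (maximalGeodesic g.leviCivita p v 0) (e i 0) (e j 0) =
      if i = j then 1 else 0) :
    ∃ J : ι → Π t : ℝ, TangentSpace I (maximalGeodesic g.leviCivita p v t),
      (∀ k, IsJacobiFieldAlongOn g (maximalGeodesic g.leviCivita p v) (J k) univ) ∧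
      (∀ k t, MDifferentiableAt 𝓘(ℝ, ℝ) I.tangent (fun t ↦ (TotalSpace.mk' E
        (maximalGeodesic g.leviCivita p v t) (J k t) : TangentBundle I M)) t) ∧
      (∀ k t, MDifferentiableAt 𝓘(ℝ, ℝ) I.tangent (fun t ↦ (TotalSpace.mk' E
        (maximalGeodesic g.leviCivita p v t)
        (covariantDerivAlong g.leviCivita (maximalGeodesic g.leviCivita p v) (J k) t) :
          TangentBundle I M)) t) ∧
      (Matrix.of fun i k ↦ g.val (maximalGeodesic g.leviCivita p v 0) (J k 0) (e i 0)) = 0 ∧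
      (Matrix.of fun i k ↦ g.val (maximalGeodesic g.leviCivita p v 0)
        (covariantDerivAlong g.leviCivita (maximalGeodesic g.leviCivita p v) (J k) 0) (e i 0)) =
        1 := by
  choose J hJ hJ0 hDJ0 hJd hDJd using
    fun k ↦ jacobiField_geodesicVariation' g hcov₁ hc p v (e k 0)
  refine ⟨J, hJ, hJd, hDJd, ?_, ?_⟩
  · ext i k
    simp only [Matrix.of_apply, Matrix.zero_apply, hJ0, map_zero, zero_apply]
  · ext i k
    simp only [Matrix.of_apply, Matrix.one_apply, hDJ0, hon]
    by_cases hik : i = k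
    · subst hik; simp
    · simp [hik, Ne.symm hik]

end JacobiInitialData'

/-! ### §F12. `det A(t) ≠ 0` where `d(exp_p)_{tv}` is injective (no conjugate point) -/

section DetNonzero

open Function

variable [CompleteSpace E] [T2Space M] [I.Boundaryless]
  (g : PseudoRiemannianMetric I n E (TangentSpace I : M → Type _)) [g.HasLeviCivita]
  [CovariantDerivative.ContMDiffCovariantDerivative g.leviCivita 1]
  [CovariantDerivative.ContMDiffCovariantDerivative g.leviCivita ∞]

/-- **`det A(t) ≠ 0` before the first conjugate point** (Chavel 2006, §III.4, proof of
Thm. III.4.3: the Jacobi tensor `A(t)` is nonsingular as long as `γ(t)` is not conjugate to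
`γ(0)`; PSU 2023, Cor. 3.7.11): along `γ_v`, let `J_k(t) = ∂_s|₀ γ_{v + s w_k}(t)` be the
variation fields with initial derivatives `w_k` (a linearly independent family; `w_k = e_k(0)` in
§F11), and let the frame `e(t)` be `g`-orthonormal with `card ι = dim M`. If `d(exp_p)` is injective at `t v`
(`t ≠ 0`), the frame matrix `A(t) = (g(J_k(t), e_i(t)))` is nonsingular — since
`∑ c_k J_k(t) = d(exp_p)_{tv}(t ∑ c_k w_k)` (`velocity_geodesicVariation_eq_mfderiv_expMap`).
This is hypothesis `hdet` of §8 of `VolumeSphereTheoremProofs.lean`.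
[cite: Chavel2006, §III.4, Thm. III.4.3 (proof)] -/
theorem det_frameMatrix_ne_zero_of_mfderiv_expMap_injective
    (hc : IsGeodesicallyComplete g.leviCivita) (p : M) (v : TangentSpace I p)
    {ι : Type*} [Fintype ι] [DecidableEq ι] (w : ι → TangentSpace I p)
    (hli0 : LinearIndependent ℝ fun k ↦ (show E from w k))
    (e : ι → Π t : ℝ, TangentSpace I (maximalGeodesic g.leviCivita p v t)) {t : ℝ} (ht : t ≠ 0)
    (hon : ∀ i j, g.val (maximalGeodesic g.leviCivita p v t) (e i t) (e j t) =
      if i = j then 1 else 0)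
    (hcard : Fintype.card ι = Module.finrank ℝ E)
    (hinj : Injective (mfderiv 𝓘(ℝ, E) I
      (fun u : E ↦ expMap g.leviCivita p (show TangentSpace I p from u)) (t • (show E from v)))) :
    (Matrix.of fun i k ↦ g.val (maximalGeodesic g.leviCivita p v t)
      (velocity I (fun s' : ℝ ↦ maximalGeodesic g.leviCivita p (v + s' • w k) t) 0)
      (e i t)).det ≠ 0 := by
  intro hdet
  obtain ⟨c, hc0, hMc⟩ := Matrix.exists_mulVec_eq_zero_iff.2 hdet
  -- the fields `J_k(t)` and the combination `u = ∑ c_k J_k(t)`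
  set J : ι → TangentSpace I (maximalGeodesic g.leviCivita p v t) :=
    fun k ↦ velocity I (fun s' : ℝ ↦ maximalGeodesic g.leviCivita p (v + s' • w k) t) 0 with hJ
  set u : TangentSpace I (maximalGeodesic g.leviCivita p v t) := ∑ k, c k • J k with hu
  -- all frame coefficients of `u` vanish, so `u = 0`
  have hcoef : ∀ i, g.val (maximalGeodesic g.leviCivita p v t) u (e i t) = 0 := by
    intro i
    have h := congrFun hMc i
    simp only [Matrix.mulVec, dotProduct, Matrix.of_apply, Pi.zero_apply] at h
    simp only [hu, map_sum, map_smul, FunLike.coe_sum, FunLike.coe_smul, Finset.sum_apply,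
      Pi.smul_apply, smul_eq_mul]
    rw [← h]
    exact Finset.sum_congr rfl fun k _ ↦ by rw [hJ]; ring
  have hexp := eq_sum_bilin_smul_of_orthonormal (V := E)
    (g.val (maximalGeodesic g.leviCivita p v t)) hon hcard u
  have hu0 : u = 0 := by
    refine hexp.trans (Finset.sum_eq_zero fun i _ ↦ ?_)
    exact (congrArg (fun r : ℝ ↦ r • e i t) (hcoef i)).trans (zero_smul ℝ (e i t))
  -- `u = d(exp_p)_{tv} (t ∑ c_k w_k)`
  set L := mfderiv 𝓘(ℝ, E) I (fun u : E ↦ expMap g.leviCivita p (show TangentSpace I p from u))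
    (t • (show E from v)) with hL
  have hJL : ∀ k, J k = L (t • (show E from w k)) := fun k ↦
    velocity_geodesicVariation_eq_mfderiv_expMap hc p v (w k) t
  have h1 : L (t • ∑ k, c k • (show E from w k)) = ∑ k, c k • L (t • (show E from w k)) := by
    calc L (t • ∑ k, c k • (show E from w k)) = L (∑ k, t • (c k • (show E from w k))) := by
          rw [Finset.smul_sum]; rfl
      _ = ∑ k, L (t • (c k • (show E from w k))) := map_sum L _ _
      _ = ∑ k, c k • L (t • (show E from w k)) := Finset.sum_congr rfl fun k _ ↦ by
          rw [smul_comm]; exact map_smul L (c k) _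
  have huL : u = L (t • ∑ k, c k • (show E from w k)) := by
    rw [h1, hu]
    exact Finset.sum_congr rfl fun k _ ↦ congrArg (fun z ↦ c k • z) (hJL k)
  -- injectivity: `t ∑ c_k w_k = 0`, hence `c = 0`
  have hker : t • ∑ k, c k • (show E from w k) = 0 := by
    refine hinj ?_
    rw [← huL, hu0]
    exact (map_zero L).symm
  have hsum : ∑ k, c k • (show E from w k) = 0 := (smul_eq_zero.1 hker).resolve_left ht
  have hc : ∀ k, c k = 0 := Fintype.linearIndependent_iff.1 hli0 c hsum
  exact hc0 (funext hc)

end DetNonzero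

/-! ### §F13. The normal block: Jacobi fields normal to `γ̇`, non-spanning frames, and
`tr R_⊥ = Ric(γ̇, γ̇)` (Chavel 2006, (III.1.5) on `γ̇^⊥`) -/

section NormalBlock

variable (g : PseudoRiemannianMetric I n E (TangentSpace I : M → Type _))

/-- **Trace over the normal frame** (Chavel 2006, §III.4, `tr R(t) = Ric(γ', γ')` for the
`(n-1) × (n-1)` matrix on `γ'^⊥`): if `f : Option ι → T_xM` is `g`-orthonormal with
`card (Option ι) = dim M` and `f none = u`, then `∑_{i : ι} g(R(f i, u)u, f i) = Ric(u, u)` — the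
missing term `g(R(u, u)u, u)` vanishes (`val_curvature_self_dir`).
[cite: Chavel2006, §III.4, proof of Thm. III.4.3] -/
theorem sum_val_curvature_normal_eq_ricci {ι : Type*} [Fintype ι] [DecidableEq ι]
    (cov : CovariantDerivative I E (TangentSpace I : M → Type _)) (x : M)
    {f : Option ι → TangentSpace I x} (hon : ∀ a b, g.val x (f a) (f b) = if a = b then 1 else 0)
    (hcard : Fintype.card (Option ι) = Module.finrank ℝ E) :
    ∑ i : ι, g.val x (cov.curvature x (f (some i)) (f none) (f none)) (f (some i)) =
      cov.ricci x (f none) (f none) := by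
  rw [← sum_val_curvature_eq_ricci g cov x hon hcard (f none), Fintype.sum_option,
    val_curvature_self_dir g cov x (f none) (f none), zero_add]

/-- **The Jacobi equation in a (possibly non-spanning) parallel orthonormal frame containing the
field**: as `hasDerivAt_val_covariantDerivAlong_frame`, but with the spanning hypothesis
`card ι = dim M` replaced by the expansion `J(t) = ∑ⱼ g(J, eⱼ) eⱼ (t)` of the field itself — the
case of normal Jacobi fields in a parallel orthonormal frame of `γ̇^⊥` (Chavel 2006, (III.1.5)).
[cite: Chavel2006, §III.1, (III.1.3)–(III.1.5)] -/
theorem hasDerivAt_val_covariantDerivAlong_frame_of_expansion [Fact (1 ≤ n)] [CompleteSpace E]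
    [g.HasLeviCivita] {ι : Type*} [Fintype ι] {γ : ℝ → M}
    {J : Π t : ℝ, TangentSpace I (γ t)} {e : ι → Π t : ℝ, TangentSpace I (γ t)} {s : Set ℝ}
    {t : ℝ} (hJ : IsJacobiFieldAlongOn g γ J s)
    (hDJ : MDifferentiableAt 𝓘(ℝ, ℝ) I.tangent
      (fun t ↦ (TotalSpace.mk' E (γ t) (covariantDerivAlong g.leviCivita γ J t) :
        TangentBundle I M)) t)
    (he : ∀ i, IsParallelAlongOn g.leviCivita γ (e i) s) (ht : t ∈ s)
    (hexp : J t = ∑ j, g.val (γ t) (J t) (e j t) • e j t) (i : ι) :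
    HasDerivAt (fun t ↦ g.val (γ t) (covariantDerivAlong g.leviCivita γ J t) (e i t))
      (-∑ j, g.val (γ t) (g.leviCivita.curvature (γ t) (e j t) (velocity I γ t) (velocity I γ t))
        (e i t) * g.val (γ t) (J t) (e j t)) t := by
  have h := hasDerivAt_val_covariantDerivAlong_of_isJacobiFieldAlongOn g hJ hDJ (he i) ht
  have hR : g.val (γ t) (g.leviCivita.curvature (γ t) (J t) (velocity I γ t) (velocity I γ t))
      (e i t) = ∑ j, g.val (γ t) (g.leviCivita.curvature (γ t) (e j t) (velocity I γ t)
        (velocity I γ t)) (e i t) * g.val (γ t) (J t) (e j t) := by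
    conv_lhs => rw [hexp]
    simp only [map_sum, map_smul, FunLike.coe_sum, FunLike.coe_smul, Finset.sum_apply,
      Pi.smul_apply, smul_eq_mul]
    exact Finset.sum_congr rfl fun j _ ↦ by ring
  rw [hR] at h
  exact h

/-- **Jacobi fields with normal initial data stay normal** (Chavel 2006, §III.1: "if `Y(0)` and
`∇_t Y(0)` are orthogonal to `γ'` then `Y ⊥ γ'` along `γ`"): along a geodesic `γ` (on all of `ℝ`)
of the Levi-Civita connection (locally `C¹`, `n ≥ 2`), a Jacobi field `J` with differentiable
lifts of `J`, `D_t J` satisfies `(g(J, γ̇))' = g(D_t J, γ̇)` and `(g(D_t J, γ̇))' = 0`; hence if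
`g(J, γ̇)` and `g(D_t J, γ̇)` vanish at `0` they vanish identically.
[cite: Chavel2006, §III.1 (normal Jacobi fields)] -/
theorem val_velocity_eq_zero_of_isJacobiFieldAlongOn [Fact (1 ≤ n)] [CompleteSpace E]
    [g.HasLeviCivita] (hreg : g.leviCivita.IsLocallyContMDiff 1) (hn : 2 ≤ n) {γ : ℝ → M}
    (hgeo : IsGeodesicOn g.leviCivita γ univ) {J : Π t : ℝ, TangentSpace I (γ t)}
    (hJ : IsJacobiFieldAlongOn g γ J univ)
    (hJd : ∀ t, MDifferentiableAt 𝓘(ℝ, ℝ) I.tangent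
      (fun t ↦ (TotalSpace.mk' E (γ t) (J t) : TangentBundle I M)) t)
    (hDJd : ∀ t, MDifferentiableAt 𝓘(ℝ, ℝ) I.tangent
      (fun t ↦ (TotalSpace.mk' E (γ t) (covariantDerivAlong g.leviCivita γ J t) :
        TangentBundle I M)) t)
    (h0 : g.val (γ 0) (J 0) (velocity I γ 0) = 0)
    (h0' : g.val (γ 0) (covariantDerivAlong g.leviCivita γ J 0) (velocity I γ 0) = 0) (t : ℝ) :
    g.val (γ t) (J t) (velocity I γ t) = 0 ∧
      g.val (γ t) (covariantDerivAlong g.leviCivita γ J t) (velocity I γ t) = 0 := by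
  have hLC := PseudoRiemannianMetric.isLeviCivita_leviCivita_holds (g := g)
  have hpar : IsParallelAlongOn g.leviCivita γ (fun t ↦ velocity I γ t) univ :=
    IsGeodesicOn.isParallelAlongOn_velocity hgeo
  -- `b(t) = g(D_t J, γ̇)` has zero derivative, hence is constant `= 0`
  set b : ℝ → ℝ := fun t ↦ g.val (γ t) (covariantDerivAlong g.leviCivita γ J t) (velocity I γ t)
    with hb
  have hb' : ∀ s, HasDerivAt b 0 s := fun s ↦ by
    have h := hasDerivAt_val_covariantDerivAlong_of_isJacobiFieldAlongOn g hJ (hDJd s) hpar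
      (mem_univ s)
    rw [PseudoRiemannianMetric.val_curvature_self_eq_zero hLC.2 hreg hn (γ s) (J s)
      (velocity I γ s) (velocity I γ s), neg_zero] at h
    exact h
  have hbconst : ∀ s, b s = b 0 := fun s ↦
    is_const_of_deriv_eq_zero (fun s ↦ (hb' s).differentiableAt) (fun s ↦ (hb' s).deriv) s 0
  have hb0 : ∀ s, b s = 0 := fun s ↦ (hbconst s).trans h0'
  -- `a(t) = g(J, γ̇)` has derivative `b = 0`, hence is constant `= 0`
  set a : ℝ → ℝ := fun t ↦ g.val (γ t) (J t) (velocity I γ t) with ha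
  have ha' : ∀ s, HasDerivAt a 0 s := fun s ↦ by
    have h := hasDerivAt_val_apply_of_isParallelAlongOn g hLC.2 (hJd s) hpar (mem_univ s)
    have hbs : g.val (γ s) (covariantDerivAlong g.leviCivita γ J s) (velocity I γ s) = 0 := hb0 s
    rw [hbs] at h
    exact h
  have haconst : ∀ s, a s = a 0 := fun s ↦
    is_const_of_deriv_eq_zero (fun s ↦ (ha' s).differentiableAt) (fun s ↦ (ha' s).deriv) s 0
  exact ⟨(haconst t).trans h0, hb0 t⟩

/-- **Expansion of a normal vector in the normal frame**: if `f : Option ι → T_xM` is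
`g`-orthonormal with `card (Option ι) = dim M` and `g(J, f none) = 0`, then
`J = ∑_{i : ι} g(J, f i) f i` — the expansion hypothesis of
`hasDerivAt_val_covariantDerivAlong_frame_of_expansion` for a normal Jacobi field in a parallel
orthonormal frame `(e₁, …, e_{n-1}, γ̇)` (Chavel 2006, §III.1). [cite: Chavel2006, §III.1] -/
theorem eq_sum_normal_of_val_eq_zero {ι : Type*} [Fintype ι] [DecidableEq ι] (x : M)
    {f : Option ι → TangentSpace I x} (hon : ∀ a b, g.val x (f a) (f b) = if a = b then 1 else 0)
    (hcard : Fintype.card (Option ι) = Module.finrank ℝ E) {J : TangentSpace I x}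
    (hJ : g.val x J (f none) = 0) :
    J = ∑ i : ι, g.val x J (f (some i)) • f (some i) := by
  have h := eq_sum_bilin_smul_of_orthonormal (V := E) (g.val x) hon hcard J
  have h0 : g.val x J (f none) • f none = 0 :=
    (congrArg (fun r : ℝ ↦ r • f none) hJ).trans (zero_smul ℝ (f none))
  calc J = ∑ o : Option ι, g.val x J (f o) • f o := h
    _ = g.val x J (f none) • f none + ∑ i : ι, g.val x J (f (some i)) • f (some i) :=
        Fintype.sum_option _
    _ = ∑ i : ι, g.val x J (f (some i)) • f (some i) := by rw [h0, zero_add]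

end NormalBlock

/-! ### §F14. The normal block, continued: `det A_⊥(t) ≠ 0` -/

section DetNonzeroNormal

open Function

variable [CompleteSpace E] [T2Space M] [I.Boundaryless]
  (g : PseudoRiemannianMetric I n E (TangentSpace I : M → Type _)) [g.HasLeviCivita]
  [CovariantDerivative.ContMDiffCovariantDerivative g.leviCivita 1]
  [CovariantDerivative.ContMDiffCovariantDerivative g.leviCivita ∞]

/-- **`det A_⊥(t) ≠ 0` where `d(exp_p)_{tv}` is injective, normal block** (Chavel 2006,
§III.4): as `det_frameMatrix_ne_zero_of_mfderiv_expMap_injective`, for a NON-spanning frame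
`e(t)` (a frame of `γ̇(t)^⊥`), provided the variation fields `J_k(t)` are normal to `γ̇(t)` and
normal vectors expand in the frame (`eq_sum_normal_of_val_eq_zero`).
[cite: Chavel2006, §III.4, Thm. III.4.3 (proof)] -/
theorem det_frameMatrix_ne_zero_of_mfderiv_expMap_injective_normal
    (hc : IsGeodesicallyComplete g.leviCivita) (p : M) (v : TangentSpace I p)
    {ι : Type*} [Fintype ι] [DecidableEq ι] (w : ι → TangentSpace I p)
    (hli0 : LinearIndependent ℝ fun k ↦ (show E from w k))
    (e : ι → Π t : ℝ, TangentSpace I (maximalGeodesic g.leviCivita p v t)) {t : ℝ} (ht : t ≠ 0)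
    (hnormal : ∀ k, g.val (maximalGeodesic g.leviCivita p v t)
      (velocity I (fun s' : ℝ ↦ maximalGeodesic g.leviCivita p (v + s' • w k) t) 0)
      (velocity I (maximalGeodesic g.leviCivita p v) t) = 0)
    (hexpand : ∀ u : TangentSpace I (maximalGeodesic g.leviCivita p v t),
      g.val (maximalGeodesic g.leviCivita p v t) u (velocity I (maximalGeodesic g.leviCivita p v) t)
        = 0 → u = ∑ i, g.val (maximalGeodesic g.leviCivita p v t) u (e i t) • e i t)
    (hinj : Injective (mfderiv 𝓘(ℝ, E) I
      (fun u : E ↦ expMap g.leviCivita p (show TangentSpace I p from u)) (t • (show E from v)))) :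
    (Matrix.of fun i k ↦ g.val (maximalGeodesic g.leviCivita p v t)
      (velocity I (fun s' : ℝ ↦ maximalGeodesic g.leviCivita p (v + s' • w k) t) 0)
      (e i t)).det ≠ 0 := by
  intro hdet
  obtain ⟨c, hc0, hMc⟩ := Matrix.exists_mulVec_eq_zero_iff.2 hdet
  -- the fields `J_k(t)` and the combination `u = ∑ c_k J_k(t)`
  set J : ι → TangentSpace I (maximalGeodesic g.leviCivita p v t) :=
    fun k ↦ velocity I (fun s' : ℝ ↦ maximalGeodesic g.leviCivita p (v + s' • w k) t) 0 with hJ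
  set u : TangentSpace I (maximalGeodesic g.leviCivita p v t) := ∑ k, c k • J k with hu
  -- all frame coefficients of `u` vanish, so `u = 0`
  have hcoef : ∀ i, g.val (maximalGeodesic g.leviCivita p v t) u (e i t) = 0 := by
    intro i
    have h := congrFun hMc i
    simp only [Matrix.mulVec, dotProduct, Matrix.of_apply, Pi.zero_apply] at h
    simp only [hu, map_sum, map_smul, FunLike.coe_sum, FunLike.coe_smul, Finset.sum_apply,
      Pi.smul_apply, smul_eq_mul]
    rw [← h]
    exact Finset.sum_congr rfl fun k _ ↦ by rw [hJ]; ring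
  have hun : g.val (maximalGeodesic g.leviCivita p v t) u
      (velocity I (maximalGeodesic g.leviCivita p v) t) = 0 := by
    simp only [hu, map_sum, map_smul, FunLike.coe_sum, FunLike.coe_smul, Finset.sum_apply,
      Pi.smul_apply, smul_eq_mul]
    exact Finset.sum_eq_zero fun k _ ↦ by rw [hJ, hnormal k, mul_zero]
  have hexp := hexpand u hun
  have hu0 : u = 0 := by
    refine hexp.trans (Finset.sum_eq_zero fun i _ ↦ ?_)
    exact (congrArg (fun r : ℝ ↦ r • e i t) (hcoef i)).trans (zero_smul ℝ (e i t))
  -- `u = d(exp_p)_{tv} (t ∑ c_k w_k)`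
  set L := mfderiv 𝓘(ℝ, E) I (fun u : E ↦ expMap g.leviCivita p (show TangentSpace I p from u))
    (t • (show E from v)) with hL
  have hJL : ∀ k, J k = L (t • (show E from w k)) := fun k ↦
    velocity_geodesicVariation_eq_mfderiv_expMap hc p v (w k) t
  have h1 : L (t • ∑ k, c k • (show E from w k)) = ∑ k, c k • L (t • (show E from w k)) := by
    calc L (t • ∑ k, c k • (show E from w k)) = L (∑ k, t • (c k • (show E from w k))) := by
          rw [Finset.smul_sum]; rfl
      _ = ∑ k, L (t • (c k • (show E from w k))) := map_sum L _ _
      _ = ∑ k, c k • L (t • (show E from w k)) := Finset.sum_congr rfl fun k _ ↦ by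
          rw [smul_comm]; exact map_smul L (c k) _
  have huL : u = L (t • ∑ k, c k • (show E from w k)) := by
    rw [h1, hu]
    exact Finset.sum_congr rfl fun k _ ↦ congrArg (fun z ↦ c k • z) (hJL k)
  -- injectivity: `t ∑ c_k w_k = 0`, hence `c = 0`
  have hker : t • ∑ k, c k • (show E from w k) = 0 := by
    refine hinj ?_
    rw [← huL, hu0]
    exact (map_zero L).symm
  have hsum : ∑ k, c k • (show E from w k) = 0 := (smul_eq_zero.1 hker).resolve_left ht
  have hc : ∀ k, c k = 0 := Fintype.linearIndependent_iff.1 hli0 c hsum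
  exact hc0 (funext hc)

end DetNonzeroNormal

/-! ### §F15. Assembly: the normal Jacobi tensor along `γ_v` in a parallel orthonormal frame
satisfies the hypotheses of the matrix Riccati layer (§8 of `VolumeSphereTheoremProofs.lean`) -/

section Assembly

open Function

variable [CompleteSpace E] [T2Space M] [I.Boundaryless] [Fact (1 ≤ n)]
  (g : PseudoRiemannianMetric I n E (TangentSpace I : M → Type _)) [g.HasLeviCivita]
  [CovariantDerivative.ContMDiffCovariantDerivative g.leviCivita 1]
  [CovariantDerivative.ContMDiffCovariantDerivative g.leviCivita ∞]

/-- **The normal Jacobi tensor in a parallel orthonormal frame** (Chavel 2006, §III.4, set-up and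
proof of Thm. III.4.3; the geometric input of the Bishop–Gromov inequality (0.5) of the paper).
Along the geodesic `γ_v` of a complete Levi-Civita connection (locally `C¹`, `n ≥ 2`), let
`f(t) : Option ι → T_{γ_v(t)}M` be a full frame with `f(t)(none) = γ̇_v(t)`, whose normal part
`eᵢ(t) = f(t)(some i)` is parallel on an open parameter interval `(a, b) ∋ 0`, and which is
`g`-orthonormal on `(a, b)` with `card (Option ι) = dim M`. Let `J_k` be the Jacobi fields with
`J_k(0) = 0`, `D_t J_k(0) = e_k(0)` and put `A = (g(J_k, eᵢ))`, `A₁ = (g(D_t J_k, eᵢ))`,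
`R = (g(R(eⱼ, γ̇)γ̇, eᵢ))` (`ι × ι` matrices). Then on `(a, b)`: `A' = A₁`, `A₁' = -R A`,
`Rᵀ = R`, `tr R = Ric(γ̇, γ̇)`, `A(0) = 0`, `A₁(0) = 1`, and `det A(t) ≠ 0` wherever
`d(exp_p)_{tv}` is injective (`t ≠ 0`) — hypotheses `hA`, `hA'`, `hR`, `hA0`, `hA'0`, `hdet` and
the trace identity behind `hRic` of `jacobi_det_pos`, `jacobi_trace_shape_le_cot/coth`,
`bishopGromov_polar_of_ricci_ge` of the first proofs file.
[cite: Chavel2006, §III.4, Thm. III.4.3; CheegerColding1997, (0.5)] -/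
theorem normalJacobiTensor_frame (hreg : g.leviCivita.IsLocallyContMDiff 1) (hn : 2 ≤ n)
    (hc : IsGeodesicallyComplete g.leviCivita) (p : M) (v : TangentSpace I p)
    {ι : Type*} [Fintype ι] [DecidableEq ι] {a b : ℝ} (h0 : (0 : ℝ) ∈ Ioo a b)
    (f : Π t : ℝ, Option ι → TangentSpace I (maximalGeodesic g.leviCivita p v t))
    (hfnone : ∀ t, f t none = velocity I (maximalGeodesic g.leviCivita p v) t)
    (hfpar : ∀ i, IsParallelAlongOn g.leviCivita (maximalGeodesic g.leviCivita p v)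
      (fun t ↦ f t (some i)) (Ioo a b))
    (hon : ∀ t ∈ Ioo a b, ∀ o o', g.val (maximalGeodesic g.leviCivita p v t) (f t o) (f t o') =
      if o = o' then 1 else 0)
    (hcard : Fintype.card (Option ι) = Module.finrank ℝ E) :
    ∃ J : ι → Π t : ℝ, TangentSpace I (maximalGeodesic g.leviCivita p v t),
      let A : ℝ → Matrix ι ι ℝ := fun t ↦ Matrix.of fun i k ↦
        g.val (maximalGeodesic g.leviCivita p v t) (J k t) (f t (some i))
      let A₁ : ℝ → Matrix ι ι ℝ := fun t ↦ Matrix.of fun i k ↦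
        g.val (maximalGeodesic g.leviCivita p v t)
          (covariantDerivAlong g.leviCivita (maximalGeodesic g.leviCivita p v) (J k) t) (f t (some i))
      let R : ℝ → Matrix ι ι ℝ := fun t ↦ Matrix.of fun i j ↦
        g.val (maximalGeodesic g.leviCivita p v t) (g.leviCivita.curvature
          (maximalGeodesic g.leviCivita p v t) (f t (some j))
          (velocity I (maximalGeodesic g.leviCivita p v) t)
          (velocity I (maximalGeodesic g.leviCivita p v) t)) (f t (some i))
      (∀ t ∈ Ioo a b, HasDerivAt A (A₁ t) t) ∧
      (∀ t ∈ Ioo a b, HasDerivAt A₁ (-(R t * A t)) t) ∧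
      (∀ t ∈ Ioo a b, (R t).IsSymm) ∧
      (∀ t ∈ Ioo a b, (R t).trace = g.leviCivita.ricci (maximalGeodesic g.leviCivita p v t)
        (velocity I (maximalGeodesic g.leviCivita p v) t)
        (velocity I (maximalGeodesic g.leviCivita p v) t)) ∧
      A 0 = 0 ∧ A₁ 0 = 1 ∧
      ∀ t ∈ Ioo a b, t ≠ 0 → Injective (mfderiv 𝓘(ℝ, E) I
        (fun u : E ↦ expMap g.leviCivita p (show TangentSpace I p from u)) (t • (show E from v))) →
        (A t).det ≠ 0 := by
  have hLC := PseudoRiemannianMetric.isLeviCivita_leviCivita_holds (g := g)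
  obtain ⟨-, hgeo, hγ0, hγv⟩ := maximalGeodesic_of_isGeodesicallyComplete hc p v
  -- the initial derivatives `w_k = e_k(0)` read in `T_pM`, and the variation fields
  set w : ι → TangentSpace I p := fun k ↦ (show E from f 0 (some k)) with hw
  have hvw : ∀ k, v + (0 : ℝ) • w k = v := fun k ↦ by rw [zero_smul, add_zero]
  set J : ι → Π t : ℝ, TangentSpace I (maximalGeodesic g.leviCivita p v t) := fun k t ↦
    velocity I (fun s' : ℝ ↦ maximalGeodesic g.leviCivita p (v + s' • w k) t) 0 with hJdef
  have hJprop : ∀ k, IsJacobiFieldAlongOn g (maximalGeodesic g.leviCivita p v) (J k) univ ∧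
      J k 0 = 0 ∧
      covariantDerivAlong g.leviCivita (maximalGeodesic g.leviCivita p v) (J k) 0 = w k ∧
      (∀ t, MDifferentiableAt 𝓘(ℝ, ℝ) I.tangent (fun t ↦ (TotalSpace.mk' E
        (maximalGeodesic g.leviCivita p v t) (J k t) : TangentBundle I M)) t) ∧
      ∀ t, MDifferentiableAt 𝓘(ℝ, ℝ) I.tangent (fun t ↦ (TotalSpace.mk' E
        (maximalGeodesic g.leviCivita p v t)
        (covariantDerivAlong g.leviCivita (maximalGeodesic g.leviCivita p v) (J k) t) :
          TangentBundle I M)) t := by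
    intro k
    have h := jacobiField_geodesicVariation g hreg hc p v (w k)
    rw [hvw k] at h
    exact h
  refine ⟨J, ?_⟩
  intro A A₁ R
  -- normality of the `J_k` and their expansion in the normal frame
  have hnormal : ∀ k t, g.val _ (J k t) (velocity I (maximalGeodesic g.leviCivita p v) t) = 0 ∧
      g.val _ (covariantDerivAlong g.leviCivita (maximalGeodesic g.leviCivita p v) (J k) t)
        (velocity I (maximalGeodesic g.leviCivita p v) t) = 0 := by
    intro k t
    refine val_velocity_eq_zero_of_isJacobiFieldAlongOn g hreg hn hgeo (hJprop k).1
      (hJprop k).2.2.2.1 (hJprop k).2.2.2.2 ?_ ?_ t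
    · rw [(hJprop k).2.1, map_zero, zero_apply]
    · rw [(hJprop k).2.2.1, ← hfnone 0]
      have h := hon 0 h0 (some k) none
      simpa using h
  have hexpand : ∀ t ∈ Ioo a b, ∀ u : TangentSpace I (maximalGeodesic g.leviCivita p v t),
      g.val _ u (velocity I (maximalGeodesic g.leviCivita p v) t) = 0 →
        u = ∑ i, g.val _ u (f t (some i)) • f t (some i) := by
    intro t ht u hu
    refine eq_sum_normal_of_val_eq_zero g (maximalGeodesic g.leviCivita p v t) (hon t ht) hcard ?_
    rw [hfnone t]; exact hu
  refine ⟨?_, ?_, ?_, ?_, ?_, ?_, ?_⟩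
  · -- `A' = A₁`
    intro t ht
    refine hasDerivAt_pi.2 fun i ↦ hasDerivAt_pi.2 fun k ↦ ?_
    simp only [A, A₁, Matrix.of_apply]
    exact hasDerivAt_val_apply_of_isParallelAlongOn g hLC.2 ((hJprop k).2.2.2.1 t) (hfpar i) ht
  · -- `A₁' = -R A`
    intro t ht
    refine hasDerivAt_pi.2 fun i ↦ hasDerivAt_pi.2 fun k ↦ ?_
    simp only [A, A₁, R, Matrix.of_apply, Matrix.neg_apply, Matrix.mul_apply]
    exact hasDerivAt_val_covariantDerivAlong_frame_of_expansion g
      (fun s hs ↦ (hJprop k).1 s (mem_univ s)) ((hJprop k).2.2.2.2 t) hfpar ht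
      (hexpand t ht (J k t) (hnormal k t).1) i
  · -- `Rᵀ = R`
    intro t ht
    exact isSymm_frameMatrix_curvature g hLC.2 hreg hLC.1 hn (fun i t ↦ f t (some i)) t
  · -- `tr R = Ric(γ̇, γ̇)`
    intro t ht
    simp only [R, Matrix.trace, Matrix.diag_apply, Matrix.of_apply]
    have h := sum_val_curvature_normal_eq_ricci g g.leviCivita (maximalGeodesic g.leviCivita p v t)
      (hon t ht) hcard
    rw [hfnone t] at h
    exact h
  · -- `A(0) = 0`
    ext i k
    simp only [A, Matrix.of_apply, Matrix.zero_apply, (hJprop k).2.1, map_zero, zero_apply]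
  · -- `A₁(0) = 1`
    ext i k
    simp only [A₁, Matrix.of_apply, Matrix.one_apply, (hJprop k).2.2.1]
    have h := hon 0 h0 (some k) (some i)
    simp only [Option.some.injEq] at h
    rw [show g.val (maximalGeodesic g.leviCivita p v 0) (w k) (f 0 (some i)) =
      g.val (maximalGeodesic g.leviCivita p v 0) (f 0 (some k)) (f 0 (some i)) from rfl, h]
    by_cases hik : i = k
    · subst hik; simp
    · simp [hik, Ne.symm hik]
  · -- `det A(t) ≠ 0` where `d(exp_p)_{tv}` is injective
    intro t ht ht0 hinj
    have hw0 : LinearIndependent ℝ fun k ↦ (show E from w k) := by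
      have hon0 : ∀ i j, g.val (maximalGeodesic g.leviCivita p v 0) (f 0 (some i)) (f 0 (some j)) =
          if i = j then 1 else 0 := fun i j ↦ by
        have h := hon 0 h0 (some i) (some j)
        simp only [Option.some.injEq] at h
        exact h
      exact linearIndependent_of_bilin_orthonormal (V := E)
        (g.val (maximalGeodesic g.leviCivita p v 0)) hon0
    exact det_frameMatrix_ne_zero_of_mfderiv_expMap_injective_normal g hc p v w hw0
      (fun i t ↦ f t (some i)) ht0 (fun k ↦ (hnormal k t).1) (hexpand t ht) hinj

end Assembly

/-! ### §F16. The Ricci lower bound in the frame: `tr R(t) ≥ (dim - 1) κ` -/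

section RicciBound

variable (g : PseudoRiemannianMetric I n E (TangentSpace I : M → Type _))

/-- **From `Ric ≥ (dim-1) κ g` to `tr R_⊥(t) ≥ card ι · κ`** (the hypothesis `hRic` of §8 of
`VolumeSphereTheoremProofs.lean`, with `κ = 1`: `card ι ≤ tr R(t)`, and `κ = -1`:
`-card ι ≤ tr R(t)`): for a full `g`-orthonormal frame `f : Option ι → T_xM` with
`card (Option ι) = dim M` and unit vector `u = f none`, a Ricci lower bound
`(dim M - 1) κ g(u, u) ≤ Ric(u, u)` gives `card ι · κ ≤ ∑ᵢ g(R(fᵢ, u)u, fᵢ)` — since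
`card ι = dim M - 1`, `g(u,u) = 1` and the sum is `Ric(u, u)` (`sum_val_curvature_normal_eq_ricci`).
[cite: CheegerColding1997, (0.2) `Ric ≥ -(n-1)` and Thm A.1.10 `Ric ≥ n-1`; Chavel2006, §III.4, Thm. III.4.3] -/
theorem card_mul_le_sum_val_curvature_of_ricci_ge {ι : Type*} [Fintype ι] [DecidableEq ι]
    (cov : CovariantDerivative I E (TangentSpace I : M → Type _)) (x : M) {κ : ℝ}
    {f : Option ι → TangentSpace I x} (hon : ∀ a b, g.val x (f a) (f b) = if a = b then 1 else 0)
    (hcard : Fintype.card (Option ι) = Module.finrank ℝ E)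
    (hRic : ((Module.finrank ℝ E : ℝ) - 1) * κ * g.val x (f none) (f none) ≤
      cov.ricci x (f none) (f none)) :
    (Fintype.card ι : ℝ) * κ ≤
      ∑ i : ι, g.val x (cov.curvature x (f (some i)) (f none) (f none)) (f (some i)) := by
  rw [sum_val_curvature_normal_eq_ricci g cov x hon hcard]
  have h1 : g.val x (f none) (f none) = 1 := by rw [hon]; simp
  have h2 : (Fintype.card ι : ℝ) = (Module.finrank ℝ E : ℝ) - 1 := by
    rw [← hcard, Fintype.card_option]; push_cast; ring
  rw [h2]
  simpa [h1] using hRic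

end RicciBound

/-! ### §F17. Continuity of the curvature along a curve (towards `hRc`) -/

section CurvatureContinuity

variable [CompleteSpace E]

variable (g : PseudoRiemannianMetric I n E (TangentSpace I : M → Type _))

/-- **The frame components of `g(R(·,·)·,·)` are continuous** (O'Neill 1983, Lemma 3.35: `R` is a
tensor field; `Lorentzian/CurvatureRegularity.lean`): for a covariant derivative locally `C¹` and
`C^∞`, the local frame `sᵢ` of the trivialisation at `x₁` and indices `k, l, m, q`, the function
`y ↦ g_y(R_y(s_k, s_l) s_m, s_q)` is continuous at every point of the base set. [cite: ONeill1983, Ch. 3, Lemma 3.35] -/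
theorem continuousAt_val_curvature_localFrame
    (cov : CovariantDerivative I E (TangentSpace I : M → Type _)) (h1 : cov.IsLocallyContMDiff 1)
    (hinf : cov.IsLocallyContMDiff (⊤ : ℕ∞)) (x₁ : M) {ι : Type*} (b : Module.Basis ι ℝ E)
    (k l m q : ι) {y : M} (hy : y ∈ (trivializationAt E (TangentSpace I : M → Type _) x₁).baseSet) :
    ContinuousAt (fun y ↦ g.val y (cov.curvature y
      ((trivializationAt E (TangentSpace I : M → Type _) x₁).localFrame b k y)
      ((trivializationAt E (TangentSpace I : M → Type _) x₁).localFrame b l y)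
      ((trivializationAt E (TangentSpace I : M → Type _) x₁).localFrame b m y))
      ((trivializationAt E (TangentSpace I : M → Type _) x₁).localFrame b q y)) y := by
  set e := trivializationAt E (TangentSpace I : M → Type _) x₁ with he
  have hopen : IsOpen e.baseSet := e.open_baseSet
  have hs : ∀ i, CMDiff[e.baseSet] ∞ (T% (e.localFrame b i)) := fun i ↦
    e.contMDiffOn_localFrame_baseSet (I := I) ∞ b i
  have hR := contMDiffOn_curvature_apply h1 hinf hopen (hs k) (hs l) (hs m)
  have hRy := (hR y hy).contMDiffAt (hopen.mem_nhds hy)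
  have hsy := ((hs q) y hy).contMDiffAt (hopen.mem_nhds hy)
  have h := PseudoRiemannianMetric.contMDiffAt_val_apply g (m := 0) bot_le (hRy.of_le bot_le)
    (hsy.of_le bot_le)
  exact h.continuousAt

omit [CompleteSpace E] in
/-- **Frame coefficients of a continuous field along a curve are continuous**: if the lift
`t ↦ (γ t, W t)` is continuous at `t₀` and `γ t₀` lies in the base set of the trivialisation `e`
at `x₁`, the coordinate functions `t ↦ (b.repr (e (γ t, W t)).2) i` are continuous at `t₀`.
[folklore] -/
theorem continuousAt_repr_trivializationAt_lift (x₁ : M) {ι : Type*} (b : Module.Basis ι ℝ E)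
    {γ : ℝ → M} {W : Π t : ℝ, TangentSpace I (γ t)} {t₀ : ℝ}
    (hW : ContinuousAt (fun t ↦ (TotalSpace.mk' E (γ t) (W t) : TangentBundle I M)) t₀)
    (hγ : γ t₀ ∈ (trivializationAt E (TangentSpace I : M → Type _) x₁).baseSet) (i : ι) :
    ContinuousAt (fun t ↦ b.repr ((trivializationAt E (TangentSpace I : M → Type _) x₁)
      (TotalSpace.mk' E (γ t) (W t))).2 i) t₀ := by
  set e := trivializationAt E (TangentSpace I : M → Type _) x₁ with he
  have hsrc : (TotalSpace.mk' E (γ t₀) (W t₀) : TangentBundle I M) ∈ e.source := by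
    rw [e.mem_source]; exact hγ
  have he_cont : ContinuousAt (fun z : TangentBundle I M ↦ e z)
      (TotalSpace.mk' E (γ t₀) (W t₀)) :=
    e.toOpenPartialHomeomorph.continuousAt hsrc
  have h2 : ContinuousAt (fun t ↦ (e (TotalSpace.mk' E (γ t) (W t))).2) t₀ :=
    continuousAt_snd.comp (ContinuousAt.comp (f := fun t ↦ (TotalSpace.mk' E (γ t) (W t) :
      TangentBundle I M)) he_cont hW)
  exact ((b.coord i).continuous_of_finiteDimensional.continuousAt).comp h2

omit [FiniteDimensional ℝ E] [CompleteSpace E] in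
/-- Expansion of a tangent vector in the local frame of the trivialisation at `x₁`, with the
coefficients read off in the trivialisation: `W = ∑ᵢ (b.repr (e(y, W)).2)ᵢ sᵢ(y)`. [folklore] -/
theorem eq_sum_repr_smul_localFrame (x₁ : M) {ι : Type*} [Fintype ι] (b : Module.Basis ι ℝ E)
    {y : M} (hy : y ∈ (trivializationAt E (TangentSpace I : M → Type _) x₁).baseSet)
    (W : TangentSpace I y) :
    W = ∑ i, b.repr ((trivializationAt E (TangentSpace I : M → Type _) x₁)
      (TotalSpace.mk' E y W)).2 i • (trivializationAt E (TangentSpace I : M → Type _) x₁).localFrame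
        b i y := by
  set e := trivializationAt E (TangentSpace I : M → Type _) x₁ with he
  have h := ((e.basisAt b hy).sum_repr W).symm
  conv_lhs => rw [h]
  refine Finset.sum_congr rfl fun i _ ↦ ?_
  rw [e.localFrame_apply_of_mem_baseSet b hy]
  congr 1

/-- **`g(R(V₁, V₂)V₃, V₄)` is continuous along a curve** for fields `V₁, …, V₄` along `γ` whose
lifts are continuous at `t₀` (covariant derivative locally `C¹` and `C^∞`): expand the fields in
the local frame at `γ t₀` (continuous coefficients, `continuousAt_repr_trivializationAt_lift`)
and use the continuity of the frame components of the curvature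
(`continuousAt_val_curvature_localFrame`). This gives hypothesis `hRc` (continuity of
`R(t) = (g(R(eⱼ, γ̇)γ̇, eᵢ))`) of §8 of `VolumeSphereTheoremProofs.lean`.
[cite: ONeill1983, Ch. 3, Lemma 3.35] -/
theorem continuousAt_val_curvature_along
    (cov : CovariantDerivative I E (TangentSpace I : M → Type _)) (h1 : cov.IsLocallyContMDiff 1)
    (hinf : cov.IsLocallyContMDiff (⊤ : ℕ∞)) {γ : ℝ → M}
    {V₁ V₂ V₃ V₄ : Π t : ℝ, TangentSpace I (γ t)} {t₀ : ℝ}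
    (hV₁ : ContinuousAt (fun t ↦ (TotalSpace.mk' E (γ t) (V₁ t) : TangentBundle I M)) t₀)
    (hV₂ : ContinuousAt (fun t ↦ (TotalSpace.mk' E (γ t) (V₂ t) : TangentBundle I M)) t₀)
    (hV₃ : ContinuousAt (fun t ↦ (TotalSpace.mk' E (γ t) (V₃ t) : TangentBundle I M)) t₀)
    (hV₄ : ContinuousAt (fun t ↦ (TotalSpace.mk' E (γ t) (V₄ t) : TangentBundle I M)) t₀) :
    ContinuousAt (fun t ↦ g.val (γ t) (cov.curvature (γ t) (V₁ t) (V₂ t) (V₃ t)) (V₄ t)) t₀ := by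
  set x₁ := γ t₀ with hx₁
  set e := trivializationAt E (TangentSpace I : M → Type _) x₁ with he
  set b := Module.finBasis ℝ E with hb
  have hγ : ContinuousAt γ t₀ := by
    have : ContinuousAt (fun t ↦ (TotalSpace.mk' E (γ t) (V₁ t) : TangentBundle I M).proj) t₀ :=
      (FiberBundle.continuous_proj E (TangentSpace I : M → Type _)).continuousAt.comp hV₁
    exact this
  have hbase₀ : γ t₀ ∈ e.baseSet := by
    simp [he, hx₁]
  have hnear : ∀ᶠ t in 𝓝 t₀, γ t ∈ e.baseSet := hγ.preimage_mem_nhds (e.open_baseSet.mem_nhds hbase₀)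
  -- coefficients and frame components, all continuous at `t₀`
  set c₁ : Fin (Module.finrank ℝ E) → ℝ → ℝ := fun i t ↦ b.repr (e (TotalSpace.mk' E (γ t) (V₁ t))).2 i
  set c₂ : Fin (Module.finrank ℝ E) → ℝ → ℝ := fun i t ↦ b.repr (e (TotalSpace.mk' E (γ t) (V₂ t))).2 i
  set c₃ : Fin (Module.finrank ℝ E) → ℝ → ℝ := fun i t ↦ b.repr (e (TotalSpace.mk' E (γ t) (V₃ t))).2 i
  set c₄ : Fin (Module.finrank ℝ E) → ℝ → ℝ := fun i t ↦ b.repr (e (TotalSpace.mk' E (γ t) (V₄ t))).2 i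
  have hc₁ : ∀ i, ContinuousAt (c₁ i) t₀ := continuousAt_repr_trivializationAt_lift x₁ b hV₁ hbase₀
  have hc₂ : ∀ i, ContinuousAt (c₂ i) t₀ := continuousAt_repr_trivializationAt_lift x₁ b hV₂ hbase₀
  have hc₃ : ∀ i, ContinuousAt (c₃ i) t₀ := continuousAt_repr_trivializationAt_lift x₁ b hV₃ hbase₀
  have hc₄ : ∀ i, ContinuousAt (c₄ i) t₀ := continuousAt_repr_trivializationAt_lift x₁ b hV₄ hbase₀
  set Φ : Fin (Module.finrank ℝ E) → Fin (Module.finrank ℝ E) → Fin (Module.finrank ℝ E) →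
      Fin (Module.finrank ℝ E) → M → ℝ := fun k l m q y ↦ g.val y (cov.curvature y
        (e.localFrame b k y) (e.localFrame b l y) (e.localFrame b m y)) (e.localFrame b q y) with hΦ
  have hΦc : ∀ k l m q, ContinuousAt (fun t ↦ Φ k l m q (γ t)) t₀ := fun k l m q ↦
    (continuousAt_val_curvature_localFrame g cov h1 hinf x₁ b k l m q hbase₀).comp hγ
  -- the expansion, valid near `t₀`
  have hexp : (fun t ↦ g.val (γ t) (cov.curvature (γ t) (V₁ t) (V₂ t) (V₃ t)) (V₄ t)) =ᶠ[𝓝 t₀]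
      fun t ↦ ∑ q, c₄ q t * ∑ m, c₃ m t * ∑ l, c₂ l t * ∑ k, c₁ k t * Φ k l m q (γ t) := by
    filter_upwards [hnear] with t ht
    have e₁ := eq_sum_repr_smul_localFrame (I := I) x₁ b ht (V₁ t)
    have e₂ := eq_sum_repr_smul_localFrame (I := I) x₁ b ht (V₂ t)
    have e₃ := eq_sum_repr_smul_localFrame (I := I) x₁ b ht (V₃ t)
    have e₄ := eq_sum_repr_smul_localFrame (I := I) x₁ b ht (V₄ t)
    conv_lhs => rw [e₁, e₂, e₃, e₄]
    simp only [map_sum, map_smul, FunLike.coe_sum, FunLike.coe_smul, Finset.sum_apply,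
      Pi.smul_apply, smul_eq_mul, Finset.mul_sum]
    rfl
  -- continuity of the expanded expression
  have hsum : ∀ {F : Fin (Module.finrank ℝ E) → ℝ → ℝ}, (∀ i, ContinuousAt (F i) t₀) →
      ContinuousAt (fun t ↦ ∑ i, F i t) t₀ := fun hF ↦
    tendsto_finsetSum _ fun i _ ↦ hF i
  have hG : ContinuousAt
      (fun t ↦ ∑ q, c₄ q t * ∑ m, c₃ m t * ∑ l, c₂ l t * ∑ k, c₁ k t * Φ k l m q (γ t)) t₀ := by
    refine hsum fun q ↦ (hc₄ q).mul (hsum fun m ↦ (hc₃ m).mul (hsum fun l ↦ (hc₂ l).mul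
      (hsum fun k ↦ (hc₁ k).mul (hΦc k l m q))))
  exact hG.congr_of_eventuallyEq hexp

/-- **Continuity of the frame curvature matrix `R(t)`** (hypothesis `hRc` of §8 of
`VolumeSphereTheoremProofs.lean`): along a geodesic `γ` (velocity lift differentiable on `s`),
for fields `eᵢ` with differentiable lifts on `s` (e.g. a parallel frame), the matrix
`R(t) = (g(R(eⱼ, γ̇)γ̇, eᵢ))(t)` is continuous at every `t₀ ∈ s`.
[cite: Chavel2006, §III.4, Thm. III.4.3 (set-up); ONeill1983, Ch. 3, Lemma 3.35] -/
theorem continuousAt_frameMatrix_curvature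
    (cov : CovariantDerivative I E (TangentSpace I : M → Type _)) (h1 : cov.IsLocallyContMDiff 1)
    (hinf : cov.IsLocallyContMDiff (⊤ : ℕ∞)) {ι : Type*} [Fintype ι] {γ : ℝ → M} {s : Set ℝ}
    (hγ : IsGeodesicOn cov γ s) {e : ι → Π t : ℝ, TangentSpace I (γ t)}
    (he : ∀ i, IsParallelAlongOn cov γ (e i) s) {t₀ : ℝ} (ht₀ : t₀ ∈ s) :
    ContinuousAt (fun t ↦ Matrix.of fun i j ↦ g.val (γ t)
      (cov.curvature (γ t) (e j t) (velocity I γ t) (velocity I γ t)) (e i t)) t₀ := by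
  have hT : ContinuousAt (fun t ↦ (TotalSpace.mk' E (γ t) (velocity I γ t) : TangentBundle I M))
      t₀ := (hγ.1 t₀ ht₀).continuousAt
  have hE : ∀ i, ContinuousAt (fun t ↦ (TotalSpace.mk' E (γ t) (e i t) : TangentBundle I M)) t₀ :=
    fun i ↦ ((he i) t₀ ht₀).1.continuousAt
  refine continuousAt_pi.2 fun i ↦ continuousAt_pi.2 fun j ↦ ?_
  exact continuousAt_val_curvature_along g cov h1 hinf (hE j) hT hT (hE i)

end CurvatureContinuity

/-! ### §F18. Closing the loop: no conjugate point before `π` (Myers–Bonnet, frame form) -/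

section LengthLePi

open Function

variable [CompleteSpace E] [T2Space M] [I.Boundaryless] [Fact (1 ≤ n)]
  (g : PseudoRiemannianMetric I n E (TangentSpace I : M → Type _)) [g.HasLeviCivita]
  [CovariantDerivative.ContMDiffCovariantDerivative g.leviCivita 1]
  [CovariantDerivative.ContMDiffCovariantDerivative g.leviCivita ∞]

/-- **No conjugate point of `γ_v` before `π` under `Ric ≥ dim - 1`** (the Bonnet–Myers conjugate
point estimate in the frame form of Chavel 2006, Thm. III.4.3 / §III.2, as used for (0.5) of the
paper with `Ric ≥ n-1`): along the unit-speed geodesic `γ_v` of a complete Levi-Civita connection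
(locally `C¹` and `C^∞`, `n ≥ 2`), given a full frame `f(t) : Option ι → T_{γ_v t}M`
(`f(t) none = γ̇_v(t)`, normal part parallel on `(a, b) ∋ 0`, `g`-orthonormal on `(a, b)`,
`card = dim M`, `ι` nonempty) and the Ricci bound `Ric(γ̇, γ̇) ≥ dim M - 1` on `(0, b)`, if
`d(exp_p)` is injective at `t v` for every `t ∈ (0, b)` then `b ≤ π`. Proof: the normal Jacobi
tensor (`normalJacobiTensor_frame`, `continuousAt_frameMatrix_curvature`,
`card_mul_le_sum_val_curvature_of_ricci_ge`) satisfies the hypotheses of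
`jacobi_noConjugate_length_le_pi` of `VolumeSphereTheoremProofs.lean`.
[cite: Chavel2006, §III.4, Thm. III.4.3 and §III.2 (Bonnet–Myers); CheegerColding1997, (0.5)] -/
theorem noConjugate_length_le_pi_frame (hreg : g.leviCivita.IsLocallyContMDiff 1)
    (hinf : g.leviCivita.IsLocallyContMDiff (⊤ : ℕ∞)) (hn : 2 ≤ n)
    (hc : IsGeodesicallyComplete g.leviCivita) (p : M) (v : TangentSpace I p)
    {ι : Type*} [Fintype ι] [DecidableEq ι] [Nonempty ι] {a b : ℝ} (h0 : (0 : ℝ) ∈ Ioo a b)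
    (f : Π t : ℝ, Option ι → TangentSpace I (maximalGeodesic g.leviCivita p v t))
    (hfnone : ∀ t, f t none = velocity I (maximalGeodesic g.leviCivita p v) t)
    (hfpar : ∀ i, IsParallelAlongOn g.leviCivita (maximalGeodesic g.leviCivita p v)
      (fun t ↦ f t (some i)) (Ioo a b))
    (hon : ∀ t ∈ Ioo a b, ∀ o o', g.val (maximalGeodesic g.leviCivita p v t) (f t o) (f t o') =
      if o = o' then 1 else 0)
    (hcard : Fintype.card (Option ι) = Module.finrank ℝ E)
    (hRic : ∀ t ∈ Ioo 0 b, ((Module.finrank ℝ E : ℝ) - 1) ≤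
      g.leviCivita.ricci (maximalGeodesic g.leviCivita p v t)
        (velocity I (maximalGeodesic g.leviCivita p v) t)
        (velocity I (maximalGeodesic g.leviCivita p v) t))
    (hinj : ∀ t ∈ Ioo 0 b, Injective (mfderiv 𝓘(ℝ, E) I
      (fun u : E ↦ expMap g.leviCivita p (show TangentSpace I p from u)) (t • (show E from v)))) :
    b ≤ Real.pi := by
  have hb : 0 < b := h0.2
  have hIoo : Ioo 0 b ⊆ Ioo a b := Ioo_subset_Ioo h0.1.le le_rfl
  obtain ⟨J, hJ⟩ := normalJacobiTensor_frame g hreg hn hc p v h0 f hfnone hfpar hon hcard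
  obtain ⟨hA, hA', hR, htr, hA0, hA'0, hdet⟩ := hJ
  obtain ⟨-, hgeo, -, -⟩ := maximalGeodesic_of_isGeodesicallyComplete hc p v
  -- continuity of `R` at `0`
  have hRc := continuousAt_frameMatrix_curvature g g.leviCivita hreg hinf (hgeo.mono (subset_univ _))
    hfpar h0
  -- the Ricci bound in the frame
  have hRic' : ∀ t ∈ Ioo 0 b, (Fintype.card ι : ℝ) ≤ (Matrix.of fun i j ↦
      g.val (maximalGeodesic g.leviCivita p v t) (g.leviCivita.curvature
        (maximalGeodesic g.leviCivita p v t) (f t (some j))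
        (velocity I (maximalGeodesic g.leviCivita p v) t)
        (velocity I (maximalGeodesic g.leviCivita p v) t)) (f t (some i))).trace := by
    intro t ht
    have hon' := hon t (hIoo ht)
    have h := card_mul_le_sum_val_curvature_of_ricci_ge g g.leviCivita
      (maximalGeodesic g.leviCivita p v t) (κ := 1) hon' hcard (by
        rw [hfnone t, mul_one]
        have h1 : g.val (maximalGeodesic g.leviCivita p v t)
            (velocity I (maximalGeodesic g.leviCivita p v) t)
            (velocity I (maximalGeodesic g.leviCivita p v) t) = 1 := by
          rw [← hfnone t, hon']; simp
        rw [h1, mul_one]; exact hRic t ht)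
    rw [mul_one] at h
    simp only [Matrix.trace, Matrix.diag_apply, Matrix.of_apply]
    rw [hfnone t] at h
    exact h
  exact jacobi_noConjugate_length_le_pi h0 hA hA' hR hRc hA0 hA'0
    (fun t ht ↦ hdet t (hIoo ht) ht.1.ne' (hinj t ht)) hRic'

end LengthLePi


/-! ### §F19. The comparison inequalities along `γ_v`: `det A ≤ sin^{n-1}`, `det A ≤ sinh^{n-1}`
and Bishop's monotonicity (Chavel 2006, Thm. III.4.3; paper (0.5)) -/

section Comparison

open Function

variable [CompleteSpace E] [T2Space M] [I.Boundaryless] [Fact (1 ≤ n)]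
  (g : PseudoRiemannianMetric I n E (TangentSpace I : M → Type _)) [g.HasLeviCivita]
  [CovariantDerivative.ContMDiffCovariantDerivative g.leviCivita 1]
  [CovariantDerivative.ContMDiffCovariantDerivative g.leviCivita ∞]

/-- **The full hypothesis bundle of the matrix Riccati layer along `γ_v`** (`normalJacobiTensor_frame`
+ `continuousAt_frameMatrix_curvature` + no conjugate point on `(0, b)`): `hA`, `hA'`, `hR`,
`hRc`, `hA0`, `hA'0`, `hdet`, and the trace identity `tr R = Ric(γ̇, γ̇)`.
[cite: Chavel2006, §III.4, Thm. III.4.3 (set-up)] -/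
theorem normalJacobiTensor_frame_hyps (hreg : g.leviCivita.IsLocallyContMDiff 1)
    (hinf : g.leviCivita.IsLocallyContMDiff (⊤ : ℕ∞)) (hn : 2 ≤ n)
    (hc : IsGeodesicallyComplete g.leviCivita) (p : M) (v : TangentSpace I p)
    {ι : Type*} [Fintype ι] [DecidableEq ι] {a b : ℝ} (h0 : (0 : ℝ) ∈ Ioo a b)
    (f : Π t : ℝ, Option ι → TangentSpace I (maximalGeodesic g.leviCivita p v t))
    (hfnone : ∀ t, f t none = velocity I (maximalGeodesic g.leviCivita p v) t)
    (hfpar : ∀ i, IsParallelAlongOn g.leviCivita (maximalGeodesic g.leviCivita p v)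
      (fun t ↦ f t (some i)) (Ioo a b))
    (hon : ∀ t ∈ Ioo a b, ∀ o o', g.val (maximalGeodesic g.leviCivita p v t) (f t o) (f t o') =
      if o = o' then 1 else 0)
    (hcard : Fintype.card (Option ι) = Module.finrank ℝ E)
    (hinj : ∀ t ∈ Ioo 0 b, Injective (mfderiv 𝓘(ℝ, E) I
      (fun u : E ↦ expMap g.leviCivita p (show TangentSpace I p from u)) (t • (show E from v)))) :
    ∃ J : ι → Π t : ℝ, TangentSpace I (maximalGeodesic g.leviCivita p v t),
      let A : ℝ → Matrix ι ι ℝ := fun t ↦ Matrix.of fun i k ↦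
        g.val (maximalGeodesic g.leviCivita p v t) (J k t) (f t (some i))
      let A₁ : ℝ → Matrix ι ι ℝ := fun t ↦ Matrix.of fun i k ↦
        g.val (maximalGeodesic g.leviCivita p v t)
          (covariantDerivAlong g.leviCivita (maximalGeodesic g.leviCivita p v) (J k) t) (f t (some i))
      let R : ℝ → Matrix ι ι ℝ := fun t ↦ Matrix.of fun i j ↦
        g.val (maximalGeodesic g.leviCivita p v t) (g.leviCivita.curvature
          (maximalGeodesic g.leviCivita p v t) (f t (some j))
          (velocity I (maximalGeodesic g.leviCivita p v) t)
          (velocity I (maximalGeodesic g.leviCivita p v) t)) (f t (some i))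
      (∀ t ∈ Ioo a b, HasDerivAt A (A₁ t) t) ∧
      (∀ t ∈ Ioo a b, HasDerivAt A₁ (-(R t * A t)) t) ∧
      (∀ t ∈ Ioo a b, (R t).IsSymm) ∧ ContinuousAt R 0 ∧ A 0 = 0 ∧ A₁ 0 = 1 ∧
      (∀ t ∈ Ioo 0 b, (A t).det ≠ 0) ∧
      ∀ t ∈ Ioo a b, (R t).trace = g.leviCivita.ricci (maximalGeodesic g.leviCivita p v t)
        (velocity I (maximalGeodesic g.leviCivita p v) t)
        (velocity I (maximalGeodesic g.leviCivita p v) t) := by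
  have hIoo : Ioo 0 b ⊆ Ioo a b := Ioo_subset_Ioo h0.1.le le_rfl
  obtain ⟨J, hJ⟩ := normalJacobiTensor_frame g hreg hn hc p v h0 f hfnone hfpar hon hcard
  obtain ⟨hA, hA', hR, htr, hA0, hA'0, hdet⟩ := hJ
  obtain ⟨-, hgeo, -, -⟩ := maximalGeodesic_of_isGeodesicallyComplete hc p v
  have hRc := continuousAt_frameMatrix_curvature g g.leviCivita hreg hinf (hgeo.mono (subset_univ _))
    hfpar h0
  exact ⟨J, hA, hA', hR, hRc, hA0, hA'0, fun t ht ↦ hdet t (hIoo ht) ht.1.ne' (hinj t ht), htr⟩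

/-- **Bishop's comparison along `γ_v`, `Ric ≥ dim - 1`** (Chavel 2006, Thm. III.4.3 with `κ = 1`;
the model `Sⁿ`): with the frame data, the Ricci bound `Ric(γ̇, γ̇) ≥ dim M - 1` on `(0, b)` and
no conjugate point on `(0, b)`, the normal Jacobi tensor satisfies
`det A(t) ≤ sin^{dim-1} t` and `t ↦ det A(t)/sin^{dim-1} t` is non-increasing on `(0, min(b, π))`
(`jacobi_det_le_sin_pow`, `jacobi_det_div_sin_pow_antitoneOn` of the first proofs file).
[cite: Chavel2006, §III.4, Thm. III.4.3; CheegerColding1997, (0.5)] -/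
theorem det_normalJacobiTensor_le_sin_pow (hreg : g.leviCivita.IsLocallyContMDiff 1)
    (hinf : g.leviCivita.IsLocallyContMDiff (⊤ : ℕ∞)) (hn : 2 ≤ n)
    (hc : IsGeodesicallyComplete g.leviCivita) (p : M) (v : TangentSpace I p)
    {ι : Type*} [Fintype ι] [DecidableEq ι] [Nonempty ι] {a b : ℝ} (h0 : (0 : ℝ) ∈ Ioo a b)
    (f : Π t : ℝ, Option ι → TangentSpace I (maximalGeodesic g.leviCivita p v t))
    (hfnone : ∀ t, f t none = velocity I (maximalGeodesic g.leviCivita p v) t)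
    (hfpar : ∀ i, IsParallelAlongOn g.leviCivita (maximalGeodesic g.leviCivita p v)
      (fun t ↦ f t (some i)) (Ioo a b))
    (hon : ∀ t ∈ Ioo a b, ∀ o o', g.val (maximalGeodesic g.leviCivita p v t) (f t o) (f t o') =
      if o = o' then 1 else 0)
    (hcard : Fintype.card (Option ι) = Module.finrank ℝ E)
    (hRic : ∀ t ∈ Ioo 0 b, ((Module.finrank ℝ E : ℝ) - 1) ≤
      g.leviCivita.ricci (maximalGeodesic g.leviCivita p v t)
        (velocity I (maximalGeodesic g.leviCivita p v) t)
        (velocity I (maximalGeodesic g.leviCivita p v) t))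
    (hinj : ∀ t ∈ Ioo 0 b, Injective (mfderiv 𝓘(ℝ, E) I
      (fun u : E ↦ expMap g.leviCivita p (show TangentSpace I p from u)) (t • (show E from v)))) :
    ∃ J : ι → Π t : ℝ, TangentSpace I (maximalGeodesic g.leviCivita p v t),
      let A : ℝ → Matrix ι ι ℝ := fun t ↦ Matrix.of fun i k ↦
        g.val (maximalGeodesic g.leviCivita p v t) (J k t) (f t (some i))
      (∀ t ∈ Ioo 0 (min b Real.pi), (A t).det ≤ Real.sin t ^ Fintype.card ι) ∧
      AntitoneOn (fun t ↦ (A t).det / Real.sin t ^ Fintype.card ι) (Ioo 0 (min b Real.pi)) := by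
  have hIoo : Ioo 0 b ⊆ Ioo a b := Ioo_subset_Ioo h0.1.le le_rfl
  obtain ⟨J, hJ⟩ := normalJacobiTensor_frame_hyps g hreg hinf hn hc p v h0 f hfnone hfpar hon
    hcard hinj
  obtain ⟨hA, hA', hR, hRc, hA0, hA'0, hdet, htr⟩ := hJ
  have hRic' : ∀ t ∈ Ioo 0 b, (Fintype.card ι : ℝ) ≤ (Matrix.of fun i j ↦
      g.val (maximalGeodesic g.leviCivita p v t) (g.leviCivita.curvature
        (maximalGeodesic g.leviCivita p v t) (f t (some j))
        (velocity I (maximalGeodesic g.leviCivita p v) t)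
        (velocity I (maximalGeodesic g.leviCivita p v) t)) (f t (some i))).trace := by
    intro t ht
    have hon' := hon t (hIoo ht)
    have h := card_mul_le_sum_val_curvature_of_ricci_ge g g.leviCivita
      (maximalGeodesic g.leviCivita p v t) (κ := 1) hon' hcard (by
        rw [hfnone t, mul_one]
        have h1 : g.val (maximalGeodesic g.leviCivita p v t)
            (velocity I (maximalGeodesic g.leviCivita p v) t)
            (velocity I (maximalGeodesic g.leviCivita p v) t) = 1 := by
          rw [← hfnone t, hon']; simp
        rw [h1, mul_one]; exact hRic t ht)
    rw [mul_one] at h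
    simp only [Matrix.trace, Matrix.diag_apply, Matrix.of_apply]
    rw [hfnone t] at h
    exact h
  exact ⟨J, jacobi_det_le_sin_pow h0 hA hA' hR hRc hA0 hA'0 hdet hRic',
    jacobi_det_div_sin_pow_antitoneOn h0 hA hA' hR hRc hA0 hA'0 hdet hRic'⟩

/-- **Bishop's comparison along `γ_v`, `Ric ≥ -(dim - 1)`** (Chavel 2006, Thm. III.4.3 with
`κ = -1`; the normalisation (0.2) `Ric_{Mⁿ} ≥ -(n-1)` of the paper, behind (0.5)): with the frame
data, the Ricci bound `Ric(γ̇, γ̇) ≥ -(dim M - 1)` on `(0, b)` and no conjugate point on `(0, b)`,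
`det A(t) ≤ sinh^{dim-1} t` and `t ↦ det A(t)/sinh^{dim-1} t` is non-increasing on `(0, b)`
(`jacobi_det_le_sinh_pow`, `jacobi_det_div_sinh_pow_antitoneOn`).
[cite: Chavel2006, §III.4, Thm. III.4.3; CheegerColding1997, (0.2) and (0.5)] -/
theorem det_normalJacobiTensor_le_sinh_pow (hreg : g.leviCivita.IsLocallyContMDiff 1)
    (hinf : g.leviCivita.IsLocallyContMDiff (⊤ : ℕ∞)) (hn : 2 ≤ n)
    (hc : IsGeodesicallyComplete g.leviCivita) (p : M) (v : TangentSpace I p)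
    {ι : Type*} [Fintype ι] [DecidableEq ι] [Nonempty ι] {a b : ℝ} (h0 : (0 : ℝ) ∈ Ioo a b)
    (f : Π t : ℝ, Option ι → TangentSpace I (maximalGeodesic g.leviCivita p v t))
    (hfnone : ∀ t, f t none = velocity I (maximalGeodesic g.leviCivita p v) t)
    (hfpar : ∀ i, IsParallelAlongOn g.leviCivita (maximalGeodesic g.leviCivita p v)
      (fun t ↦ f t (some i)) (Ioo a b))
    (hon : ∀ t ∈ Ioo a b, ∀ o o', g.val (maximalGeodesic g.leviCivita p v t) (f t o) (f t o') =
      if o = o' then 1 else 0)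
    (hcard : Fintype.card (Option ι) = Module.finrank ℝ E)
    (hRic : ∀ t ∈ Ioo 0 b, -((Module.finrank ℝ E : ℝ) - 1) ≤
      g.leviCivita.ricci (maximalGeodesic g.leviCivita p v t)
        (velocity I (maximalGeodesic g.leviCivita p v) t)
        (velocity I (maximalGeodesic g.leviCivita p v) t))
    (hinj : ∀ t ∈ Ioo 0 b, Injective (mfderiv 𝓘(ℝ, E) I
      (fun u : E ↦ expMap g.leviCivita p (show TangentSpace I p from u)) (t • (show E from v)))) :
    ∃ J : ι → Π t : ℝ, TangentSpace I (maximalGeodesic g.leviCivita p v t),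
      let A : ℝ → Matrix ι ι ℝ := fun t ↦ Matrix.of fun i k ↦
        g.val (maximalGeodesic g.leviCivita p v t) (J k t) (f t (some i))
      (∀ t ∈ Ioo 0 b, (A t).det ≤ Real.sinh t ^ Fintype.card ι) ∧
      AntitoneOn (fun t ↦ (A t).det / Real.sinh t ^ Fintype.card ι) (Ioo 0 b) := by
  have hIoo : Ioo 0 b ⊆ Ioo a b := Ioo_subset_Ioo h0.1.le le_rfl
  obtain ⟨J, hJ⟩ := normalJacobiTensor_frame_hyps g hreg hinf hn hc p v h0 f hfnone hfpar hon
    hcard hinj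
  obtain ⟨hA, hA', hR, hRc, hA0, hA'0, hdet, htr⟩ := hJ
  have hRic' : ∀ t ∈ Ioo 0 b, -(Fintype.card ι : ℝ) ≤ (Matrix.of fun i j ↦
      g.val (maximalGeodesic g.leviCivita p v t) (g.leviCivita.curvature
        (maximalGeodesic g.leviCivita p v t) (f t (some j))
        (velocity I (maximalGeodesic g.leviCivita p v) t)
        (velocity I (maximalGeodesic g.leviCivita p v) t)) (f t (some i))).trace := by
    intro t ht
    have hon' := hon t (hIoo ht)
    have h := card_mul_le_sum_val_curvature_of_ricci_ge g g.leviCivita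
      (maximalGeodesic g.leviCivita p v t) (κ := -1) hon' hcard (by
        rw [hfnone t]
        have h1 : g.val (maximalGeodesic g.leviCivita p v t)
            (velocity I (maximalGeodesic g.leviCivita p v) t)
            (velocity I (maximalGeodesic g.leviCivita p v) t) = 1 := by
          rw [← hfnone t, hon']; simp
        rw [h1, mul_one, mul_neg_one]; exact hRic t ht)
    rw [mul_neg_one] at h
    simp only [Matrix.trace, Matrix.diag_apply, Matrix.of_apply]
    rw [hfnone t] at h
    exact h
  exact ⟨J, jacobi_det_le_sinh_pow h0 hA hA' hR hRc hA0 hA'0 hdet hRic',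
    jacobi_det_div_sinh_pow_antitoneOn h0 hA hA' hR hRc hA0 hA'0 hdet hRic'⟩

end Comparison


/-! ### §F20. A `B`-orthonormal basis with prescribed first vector (Householder reflection) -/

section Householder

variable {V : Type*} [NormedAddCommGroup V] [NormedSpace ℝ V]

/-- **Householder reflections preserve a symmetric bilinear form**: for `B` symmetric and `w`
with `B(w, w) ≠ 0`, the reflection `H x = x - (2 B(x, w)/B(w, w)) w` satisfies
`B(H x, H y) = B(x, y)`. [folklore] -/
theorem bilin_householder_householder (B : V →L[ℝ] V →L[ℝ] ℝ) (hB : ∀ x y, B x y = B y x)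
    {w : V} (hw : B w w ≠ 0) (x y : V) :
    B (x - (2 * B x w / B w w) • w) (y - (2 * B y w / B w w) • w) = B x y := by
  simp only [map_sub, map_smul, sub_apply, FunLike.coe_smul, Pi.smul_apply, smul_eq_mul]
  rw [hB w y]
  field_simp
  ring

/-- **An orthonormal basis with prescribed first vector**: if `b : Fin (k+1) → V` is
`B`-orthonormal for a symmetric bilinear form `B` which is positive definite, and `B(u, u) = 1`,
then there is a `B`-orthonormal family `f : Fin (k+1) → V` with `f 0 = u` (apply to `b` the
Householder reflection exchanging `b 0` and `u`). Used to complete `γ̇(0) = v` to a full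
orthonormal frame at `γ(0)` (§F15). [folklore] -/
theorem exists_bilin_orthonormal_head (B : V →L[ℝ] V →L[ℝ] ℝ) (hB : ∀ x y, B x y = B y x)
    (hpos : ∀ x, x ≠ 0 → 0 < B x x) {k : ℕ} {b : Fin (k + 1) → V}
    (hon : ∀ i j, B (b i) (b j) = if i = j then 1 else 0) {u : V} (hu : B u u = 1) :
    ∃ f : Fin (k + 1) → V, f 0 = u ∧ ∀ i j, B (f i) (f j) = if i = j then 1 else 0 := by
  by_cases h0 : b 0 = u
  · exact ⟨b, h0, hon⟩
  · set w : V := b 0 - u with hw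
    have hb00 : B (b 0) (b 0) = 1 := by rw [hon]; simp
    have hww : B w w = 2 * (1 - B (b 0) u) := by
      simp only [hw, map_sub, sub_apply, hB u (b 0), hb00, hu]; ring
    have hwne : B w w ≠ 0 := by
      intro hz
      have hwz : w ≠ 0 := sub_ne_zero.2 h0
      exact (hpos w hwz).ne' hz
    refine ⟨fun i ↦ b i - (2 * B (b i) w / B w w) • w, ?_, fun i j ↦ ?_⟩
    · -- `H (b 0) = u`: the coefficient is `1`
      have hc : 2 * B (b 0) w / B w w = 1 := by
        rw [div_eq_one_iff_eq hwne, hww]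
        simp only [hw, map_sub, hb00]
      show b 0 - (2 * B (b 0) w / B w w) • w = u
      rw [hc, one_smul, hw]
      abel
    · rw [bilin_householder_householder B hB hwne, hon]

/-- Reindexing a `B`-orthonormal family `f' : Fin (k+1) → V` with `f' 0 = u` as a family on
`Option (Fin k)` with value `u` at `none` (the index convention of `normalJacobiTensor_frame`).
[folklore] -/
theorem exists_bilin_orthonormal_option (B : V →L[ℝ] V →L[ℝ] ℝ) {k : ℕ} {f' : Fin (k + 1) → V}
    (hon : ∀ i j, B (f' i) (f' j) = if i = j then 1 else 0) {u : V} (hu : f' 0 = u) :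
    ∃ f : Option (Fin k) → V, f none = u ∧ ∀ o o', B (f o) (f o') = if o = o' then 1 else 0 := by
  refine ⟨fun o ↦ o.elim u fun i ↦ f' i.succ, rfl, ?_⟩
  rintro (_ | i) (_ | j)
  · simpa [← hu] using hon 0 0
  · have h := hon 0 j.succ
    simp only [(Fin.succ_ne_zero j).symm, if_false] at h
    simpa [← hu] using h
  · have h := hon i.succ 0
    simp only [Fin.succ_ne_zero i, if_false] at h
    simpa [← hu] using h
  · have h := hon i.succ j.succ
    simp only [Fin.succ_inj] at h
    simpa using h

end Householder

section FrameAtPoint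

open Literature.Geometry.Lorentzian

variable {E : Type*} [NormedAddCommGroup E] [NormedSpace ℝ E] {H : Type*} [TopologicalSpace H]
  {I : ModelWithCorners ℝ E H} {M : Type*} [TopologicalSpace M] [ChartedSpace H M]
  [IsManifold I ∞ M] [FiniteDimensional ℝ E] {n : ℕ∞ω}
  (g : PseudoRiemannianMetric I n E (TangentSpace I : M → Type _))

/-- **A full orthonormal frame at a point with prescribed unit head** (for a positive definite
metric): for `g` Riemannian and `g_x(u, u) = 1` there is a `g_x`-orthonormal family
`f : Option (Fin k) → T_xM` with `f none = u` and `card (Option (Fin k)) = dim M` — the initial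
value at `t₀` of the full frame of `normalJacobiTensor_frame` (through
`exists_parallel_orthonormal_frame_Icc`). [folklore] -/
theorem exists_orthonormal_frame_with_head (hg : g.IsRiemannian) (x : M) {u : TangentSpace I x}
    (hu : g.val x u u = 1) :
    ∃ (k : ℕ) (f : Option (Fin k) → TangentSpace I x), f none = u ∧
      (∀ o o', g.val x (f o) (f o') = if o = o' then 1 else 0) ∧
      Fintype.card (Option (Fin k)) = Module.finrank ℝ E := by
  obtain ⟨e, he⟩ := g.exists_orthonormal_basis x hg
  -- `dim ≥ 1` since `u ≠ 0`
  have hu0 : u ≠ 0 := by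
    intro h; rw [h, map_zero] at hu; simp at hu
  haveI : Nontrivial (TangentSpace I x) := nontrivial_of_ne u 0 hu0
  have hne : Nonempty (Fin (Module.finrank ℝ (TangentSpace I x))) := e.index_nonempty
  obtain ⟨k, hk⟩ : ∃ k, Module.finrank ℝ (TangentSpace I x) = k + 1 :=
    Nat.exists_eq_succ_of_ne_zero (Fin.pos_iff_nonempty.2 hne).ne'
  -- reindex the basis by `Fin (k+1)` and put `u` in front by a Householder reflection
  set b' : Fin (k + 1) → TangentSpace I x := fun i ↦ e (Fin.cast hk.symm i) with hb'
  have hon' : ∀ i j, g.val x (b' i) (b' j) = if i = j then 1 else 0 := fun i j ↦ by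
    simp only [hb', he, (Fin.cast_injective hk.symm).eq_iff]
  obtain ⟨f', hf'0, hf'⟩ := exists_bilin_orthonormal_head (V := E) (g.val x) (g.symm x)
    (fun w hw ↦ hg x w hw) hon' hu
  obtain ⟨f, hf0, hf⟩ := exists_bilin_orthonormal_option (V := E) (g.val x) hf' hf'0
  refine ⟨k, f, hf0, hf, ?_⟩
  rw [Fintype.card_option, Fintype.card_fin]
  exact hk.symm

end FrameAtPoint

end Literature.Geometry.Riemannian

/-! ### §F5. Local existence of parallel transport (O'Neill 1983, Ch. 3, Prop. 3.19) -/

namespace Literature.Geometry.Riemannian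

open Literature.Geometry.Lorentzian Literature.Analysis.ODE

section LocalParallelTransport

universe u

variable {E : Type u} [NormedAddCommGroup E] [NormedSpace ℝ E] [FiniteDimensional ℝ E]
  [CompleteSpace E] {M : Type*} [TopologicalSpace M] [ChartedSpace E M] [IsManifold 𝓘(ℝ, E) ∞ M]

/-- **Local existence of parallel transport** (O'Neill 1983, Ch. 3, Prop. 3.19, for a curve inside
one chart): along a curve `γ : [0, T] → M` lying in the chart domain of `x₁`, differentiable with
continuous coordinate velocity, every initial vector `v₀ ∈ T_{γ 0}M` extends to a field `W` along
`γ` with `W 0 = v₀` which is parallel on `(0, T)` — solve the linear parallel-transport equation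
`w' = -Γ(γ, U) w` for the coordinate vector (`Literature.Analysis.ODE.exists_solution_linear`) and
read it back through the trivialisation (`continuousLinearMapAt_covariantDerivAlong_symmL_Γmat`).
[cite: ONeill1983, Ch. 3, Prop. 3.19 (i)] -/
theorem exists_isParallelAlongOn_of_subset_chartSource
    (cov : CovariantDerivative 𝓘(ℝ, E) E (TangentSpace 𝓘(ℝ, E) : M → Type _))
    (hcov : cov.IsLocallyContMDiff ∞) (x₁ : M) {γ : ℝ → M} {T : ℝ} (hT : 0 ≤ T)
    (hγs : ∀ t ∈ Icc 0 T, γ t ∈ (chartAt E x₁).source)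
    (hγd : ∀ t ∈ Icc 0 T, MDifferentiableAt 𝓘(ℝ, ℝ) 𝓘(ℝ, E) γ t)
    (hU : ContinuousOn (fun t ↦ ((trivializationAt E (TangentSpace 𝓘(ℝ, E) : M → Type _) x₁)
        ⟨γ t, velocity 𝓘(ℝ, E) γ t⟩).2) (Icc 0 T))
    (v₀ : TangentSpace 𝓘(ℝ, E) (γ 0)) :
    ∃ W : Π t : ℝ, TangentSpace 𝓘(ℝ, E) (γ t), W 0 = v₀ ∧
      IsParallelAlongOn cov γ W (Ioo 0 T) := by
  have hbase : ∀ t ∈ Icc 0 T,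
      γ t ∈ (trivializationAt E (TangentSpace 𝓘(ℝ, E) : M → Type _) x₁).baseSet := fun t ht ↦ by
    simpa using hγs t ht
  have hsrc : ∀ t ∈ Icc 0 T, γ t ∈ (extChartAt 𝓘(ℝ, E) x₁).source := fun t ht ↦ by
    rw [extChartAt_source]; exact hγs t ht
  -- the coefficient of the parallel-transport equation, continuous on `[0, T]`
  set A : ℝ → E →L[ℝ] E := fun t ↦ -Γmat cov hcov x₁ (γ t)
      ((trivializationAt E (TangentSpace 𝓘(ℝ, E) : M → Type _) x₁) ⟨γ t, velocity 𝓘(ℝ, E) γ t⟩).2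
    with hA
  have hAcont : ContinuousOn A (Icc 0 T) := by
    have hG := (contDiffOn_Γmat cov hcov x₁).continuousOn
    have hq : ContinuousOn (fun t ↦ ((extChartAt 𝓘(ℝ, E) x₁) (γ t),
        ((trivializationAt E (TangentSpace 𝓘(ℝ, E) : M → Type _) x₁)
          ⟨γ t, velocity 𝓘(ℝ, E) γ t⟩).2)) (Icc 0 T) := by
      refine ContinuousOn.prodMk (fun t ht ↦ ?_) hU
      exact ((continuousAt_extChartAt' (hsrc t ht)).comp (hγd t ht).continuousAt).continuousWithinAt
    have hmaps : MapsTo (fun t ↦ ((extChartAt 𝓘(ℝ, E) x₁) (γ t),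
        ((trivializationAt E (TangentSpace 𝓘(ℝ, E) : M → Type _) x₁)
          ⟨γ t, velocity 𝓘(ℝ, E) γ t⟩).2)) (Icc 0 T)
        ((extChartAt 𝓘(ℝ, E) x₁).target ×ˢ univ) := fun t ht ↦
      ⟨(extChartAt 𝓘(ℝ, E) x₁).map_source (hsrc t ht), mem_univ _⟩
    have hcomp := (hG.comp hq hmaps).neg
    refine hcomp.congr fun t ht ↦ ?_
    simp only [hA, Pi.neg_apply, Function.comp_apply]
    rw [(extChartAt 𝓘(ℝ, E) x₁).left_inv (hsrc t ht)]
  -- solve `J' = A J`, `J 0 = id`, and take `w = J c₀`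
  obtain ⟨J, hJ0, hJ⟩ := exists_solution_linear hT hAcont (ContinuousLinearMap.id ℝ E)
  set c₀ : E := ((trivializationAt E (TangentSpace 𝓘(ℝ, E) : M → Type _) x₁) ⟨γ 0, v₀⟩).2
    with hc₀
  set w : ℝ → E := fun t ↦ J t c₀ with hw
  have hwderiv : ∀ t ∈ Icc 0 T, HasDerivWithinAt w (A t (w t)) (Icc 0 T) t := by
    intro t ht
    have h := (hJ t ht).clm_apply (hasDerivWithinAt_const t (Icc 0 T) c₀)
    simpa [hw] using h
  refine ⟨fun t ↦ (trivializationAt E (TangentSpace 𝓘(ℝ, E) : M → Type _) x₁).symmL ℝ (γ t) (w t),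
    ?_, ?_⟩
  · -- initial value
    have h0 : (0:ℝ) ∈ Icc 0 T := ⟨le_rfl, hT⟩
    simp only [hw, hJ0, ContinuousLinearMap.id_apply, hc₀]
    rw [← Trivialization.continuousLinearMapAt_apply_of_mem (R := ℝ)
      (e := trivializationAt E (TangentSpace 𝓘(ℝ, E) : M → Type _) x₁) (hb := hbase 0 h0) (y := v₀)]
    exact Trivialization.symmL_continuousLinearMapAt _ (hbase 0 h0) v₀
  · intro t ht
    have htI : t ∈ Icc 0 T := Ioo_subset_Icc_self ht
    have hwt : HasDerivAt w (A t (w t)) t :=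
      (hwderiv t htI).hasDerivAt (Icc_mem_nhds ht.1 ht.2)
    refine ⟨?_, ?_⟩
    · -- differentiability of the lift: a frame combination with coefficients `(w ·)ʲ`
      set b := Module.finBasis ℝ E with hb
      have hγe : ∀ᶠ t' in 𝓝 t, γ t' ∈ (chartAt E x₁).source :=
        (hγd t htI).continuousAt.preimage_mem_nhds
          ((chartAt E x₁).open_source.mem_nhds (hγs t htI))
      have hev : (fun t' ↦ (TotalSpace.mk' E (γ t')
          (∑ j, b.repr (w t') j • (trivializationAt E (TangentSpace 𝓘(ℝ, E) : M → Type _)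
            x₁).localFrame b j (γ t')) : TangentBundle 𝓘(ℝ, E) M)) =ᶠ[𝓝 t]
          fun t' ↦ (TotalSpace.mk' E (γ t')
            ((trivializationAt E (TangentSpace 𝓘(ℝ, E) : M → Type _) x₁).symmL ℝ (γ t') (w t')) :
              TangentBundle 𝓘(ℝ, E) M) := by
        filter_upwards [hγe] with t' ht'
        rw [symmL_eq_sum_localFrame b ht']
      refine MDifferentiableAt.congr_of_eventuallyEq ?_ hev.symm
      refine mdifferentiableAt_lift_sum_smul_localFrame b (hγs t htI) (hγd t htI) fun j ↦ ?_
      exact ((b.coord j).toContinuousLinearMap.differentiableAt).comp t hwt.differentiableAt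
    · -- the equation `A (DW/dt) = w' + Γ w = 0`
      have hchart := continuousLinearMapAt_covariantDerivAlong_symmL_Γmat cov hcov x₁ (hγs t htI)
        (hγd t htI) hwt.differentiableAt
      rw [hwt.deriv] at hchart
      have hzero : (trivializationAt E (TangentSpace 𝓘(ℝ, E) : M → Type _) x₁).continuousLinearMapAt
          ℝ (γ t) (covariantDerivAlong cov γ (fun t' ↦ (trivializationAt E
            (TangentSpace 𝓘(ℝ, E) : M → Type _) x₁).symmL ℝ (γ t') (w t')) t) = 0 := by
        rw [hchart, hA]
        simp
      have h := Trivialization.symmL_continuousLinearMapAt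
        (trivializationAt E (TangentSpace 𝓘(ℝ, E) : M → Type _) x₁) (R := ℝ) (hbase t htI)
        (covariantDerivAlong cov γ (fun t' ↦ (trivializationAt E
          (TangentSpace 𝓘(ℝ, E) : M → Type _) x₁).symmL ℝ (γ t') (w t')) t)
      rw [hzero, map_zero] at h
      exact h.symm

end LocalParallelTransport


/-! ### §F6. The solution operator of a linear ODE is invertible; parallel transport from any
parameter -/

section LinearSolutionOperator

variable {F : Type*} [NormedAddCommGroup F] [NormedSpace ℝ F] [CompleteSpace F]

/-- **The solution operator of a linear ODE has a left inverse** (solve the adjoint equation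
`K' = -K A`; then `(K J)' = 0`): for `A` continuous on `[0, T]` there are `J, K` with
`J 0 = K 0 = id`, `J' = A J` within `[0, T]`, and `K t ∘ J t = id` on `[0, T]`. [folklore] -/
theorem exists_solution_linear_leftInverse {A : ℝ → F →L[ℝ] F} {T : ℝ} (hT : 0 ≤ T)
    (hA : ContinuousOn A (Icc 0 T)) :
    ∃ J K : ℝ → F →L[ℝ] F, J 0 = ContinuousLinearMap.id ℝ F ∧ K 0 = ContinuousLinearMap.id ℝ F ∧
      (∀ t ∈ Icc 0 T, HasDerivWithinAt J ((A t).comp (J t)) (Icc 0 T) t) ∧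
      (∀ t ∈ Icc 0 T, HasDerivWithinAt K (-((K t).comp (A t))) (Icc 0 T) t) ∧
      ∀ t ∈ Icc 0 T, (K t).comp (J t) = ContinuousLinearMap.id ℝ F := by
  obtain ⟨J, hJ0, hJ⟩ := exists_solution_linear hT hA (ContinuousLinearMap.id ℝ F)
  -- the adjoint equation `X' = -X ∘ A(t)` as a linear ODE in `F →L F`
  set B : ℝ → (F →L[ℝ] F) →L[ℝ] (F →L[ℝ] F) :=
    fun t ↦ -((ContinuousLinearMap.compL ℝ F F F).flip (A t)) with hB
  have hBcont : ContinuousOn B (Icc 0 T) :=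
    (((ContinuousLinearMap.compL ℝ F F F).flip).continuous.comp_continuousOn hA).neg
  obtain ⟨L, hL0, hL⟩ := exists_solution_linear hT hBcont
    (ContinuousLinearMap.id ℝ (F →L[ℝ] F))
  set K : ℝ → F →L[ℝ] F := fun t ↦ L t (ContinuousLinearMap.id ℝ F) with hK
  have hK0 : K 0 = ContinuousLinearMap.id ℝ F := by simp [hK, hL0]
  have hKd : ∀ t ∈ Icc 0 T, HasDerivWithinAt K (-((K t).comp (A t))) (Icc 0 T) t := by
    intro t ht
    have h := (hL t ht).clm_apply (hasDerivWithinAt_const t (Icc 0 T) (ContinuousLinearMap.id ℝ F))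
    simp only [hB, ContinuousLinearMap.comp_apply, neg_apply,
      ContinuousLinearMap.flip_apply, ContinuousLinearMap.compL_apply, map_zero, add_zero] at h
    exact h
  -- `(K J)' = 0`, so `K J ≡ id`
  have hprod : ∀ t ∈ Icc 0 T, HasDerivWithinAt (fun t ↦ (K t).comp (J t)) 0 (Icc 0 T) t := by
    intro t ht
    have h := (hKd t ht).clm_comp (hJ t ht)
    have hz : (-((K t).comp (A t))).comp (J t) + (K t).comp ((A t).comp (J t)) = 0 := by
      rw [ContinuousLinearMap.neg_comp, ← ContinuousLinearMap.comp_assoc, neg_add_cancel]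
    rwa [hz] at h
  have hconst : ∀ t ∈ Icc 0 T, (K t).comp (J t) = (K 0).comp (J 0) := by
    have hcont : ContinuousOn (fun t ↦ (K t).comp (J t)) (Icc 0 T) := fun t ht ↦
      (hprod t ht).continuousWithinAt
    refine constant_of_has_deriv_right_zero hcont fun t ht ↦ ?_
    exact (hprod t (Ico_subset_Icc_self ht)).mono_of_mem_nhdsWithin
      (mem_of_superset (Icc_mem_nhdsGE ht.2) (Icc_subset_Icc ht.1 le_rfl))
  refine ⟨J, K, hJ0, hK0, hJ, hKd, fun t ht ↦ ?_⟩
  rw [hconst t ht, hJ0, hK0, ContinuousLinearMap.id_comp]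

/-- In finite dimensions the left inverse is a right inverse: `J t ∘ K t = id`. [folklore] -/
theorem comp_eq_id_comm {V : Type*} [NormedAddCommGroup V] [NormedSpace ℝ V]
    [FiniteDimensional ℝ V] {J K : V →L[ℝ] V} (h : K.comp J = ContinuousLinearMap.id ℝ V) :
    J.comp K = ContinuousLinearMap.id ℝ V := by
  have h1 : (K : V →ₗ[ℝ] V) * (J : V →ₗ[ℝ] V) = 1 := by
    rw [Module.End.mul_eq_comp, Module.End.one_eq_id]
    have := congrArg (fun f : V →L[ℝ] V ↦ (f : V →ₗ[ℝ] V)) h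
    simpa using this
  have h2 : (J : V →ₗ[ℝ] V) * (K : V →ₗ[ℝ] V) = 1 := mul_eq_one_comm.1 h1
  ext v
  have := LinearMap.congr_fun h2 v
  simpa using this

end LinearSolutionOperator

section ParallelTransportAt

universe u

variable {E : Type u} [NormedAddCommGroup E] [NormedSpace ℝ E] [FiniteDimensional ℝ E]
  [CompleteSpace E] {M : Type*} [TopologicalSpace M] [ChartedSpace E M] [IsManifold 𝓘(ℝ, E) ∞ M]

omit [CompleteSpace E] in
/-- **Solutions of the parallel-transport equation are parallel fields** (the computational core of
`exists_isParallelAlongOn_of_subset_chartSource`): if `γ t` lies in the chart domain of `x₁`, `γ` is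
differentiable at `t` and the coordinate vector `w` has derivative `-Γ(γ t, U t) (w t)` at `t`
(`U` the coordinate velocity), then the field `e₁.symm (γ ·) (w ·)` has a differentiable lift at
`t` and vanishing covariant derivative there. [cite: ONeill1983, Ch. 3, Prop. 3.18–3.19] -/
theorem isParallelAt_symmL_of_hasDerivAt
    (cov : CovariantDerivative 𝓘(ℝ, E) E (TangentSpace 𝓘(ℝ, E) : M → Type _))
    (hcov : cov.IsLocallyContMDiff ∞) (x₁ : M) {γ : ℝ → M} {t : ℝ}
    (hγs : γ t ∈ (chartAt E x₁).source) (hγd : MDifferentiableAt 𝓘(ℝ, ℝ) 𝓘(ℝ, E) γ t)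
    {w : ℝ → E} (hwt : HasDerivAt w (-(Γmat cov hcov x₁ (γ t)
      ((trivializationAt E (TangentSpace 𝓘(ℝ, E) : M → Type _) x₁) ⟨γ t, velocity 𝓘(ℝ, E) γ t⟩).2
        (w t))) t) :
    MDifferentiableAt 𝓘(ℝ, ℝ) 𝓘(ℝ, E).tangent (fun t' ↦ (TotalSpace.mk' E (γ t')
      ((trivializationAt E (TangentSpace 𝓘(ℝ, E) : M → Type _) x₁).symmL ℝ (γ t') (w t')) :
        TangentBundle 𝓘(ℝ, E) M)) t ∧
      covariantDerivAlong cov γ (fun t' ↦ (trivializationAt E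
        (TangentSpace 𝓘(ℝ, E) : M → Type _) x₁).symmL ℝ (γ t') (w t')) t = 0 := by
  have hbase : γ t ∈ (trivializationAt E (TangentSpace 𝓘(ℝ, E) : M → Type _) x₁).baseSet := by
    simpa using hγs
  refine ⟨?_, ?_⟩
  · set b := Module.finBasis ℝ E with hb
    have hγe : ∀ᶠ t' in 𝓝 t, γ t' ∈ (chartAt E x₁).source :=
      hγd.continuousAt.preimage_mem_nhds ((chartAt E x₁).open_source.mem_nhds hγs)
    have hev : (fun t' ↦ (TotalSpace.mk' E (γ t')
        (∑ j, b.repr (w t') j • (trivializationAt E (TangentSpace 𝓘(ℝ, E) : M → Type _)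
          x₁).localFrame b j (γ t')) : TangentBundle 𝓘(ℝ, E) M)) =ᶠ[𝓝 t]
        fun t' ↦ (TotalSpace.mk' E (γ t')
          ((trivializationAt E (TangentSpace 𝓘(ℝ, E) : M → Type _) x₁).symmL ℝ (γ t') (w t')) :
            TangentBundle 𝓘(ℝ, E) M) := by
      filter_upwards [hγe] with t' ht'
      rw [symmL_eq_sum_localFrame b ht']
    refine MDifferentiableAt.congr_of_eventuallyEq ?_ hev.symm
    refine mdifferentiableAt_lift_sum_smul_localFrame b hγs hγd fun j ↦ ?_
    exact ((b.coord j).toContinuousLinearMap.differentiableAt).comp t hwt.differentiableAt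
  · have hchart := continuousLinearMapAt_covariantDerivAlong_symmL_Γmat cov hcov x₁ hγs hγd
      hwt.differentiableAt
    rw [hwt.deriv, neg_add_cancel] at hchart
    have h := Trivialization.symmL_continuousLinearMapAt
      (trivializationAt E (TangentSpace 𝓘(ℝ, E) : M → Type _) x₁) (R := ℝ) hbase
      (covariantDerivAlong cov γ (fun t' ↦ (trivializationAt E
        (TangentSpace 𝓘(ℝ, E) : M → Type _) x₁).symmL ℝ (γ t') (w t')) t)
    rw [hchart, map_zero] at h
    exact h.symm

/-- **Parallel transport from any parameter** (O'Neill 1983, Ch. 3, Prop. 3.19, inside one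
chart): under the hypotheses of `exists_isParallelAlongOn_of_subset_chartSource`, for every
`t₀ ∈ [0, T]` and `v ∈ T_{γ t₀}M` there is a field `W` along `γ`, parallel on `(0, T)`, with
`W t₀ = v` — the solution operator `J(t)` of the parallel-transport equation is invertible
(`exists_solution_linear_leftInverse`, `comp_eq_id_comm`), so one may prescribe `w(t₀)`.
[cite: ONeill1983, Ch. 3, Prop. 3.19] -/
theorem exists_isParallelAlongOn_eq_at
    (cov : CovariantDerivative 𝓘(ℝ, E) E (TangentSpace 𝓘(ℝ, E) : M → Type _))
    (hcov : cov.IsLocallyContMDiff ∞) (x₁ : M) {γ : ℝ → M} {T : ℝ} (hT : 0 ≤ T)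
    (hγs : ∀ t ∈ Icc 0 T, γ t ∈ (chartAt E x₁).source)
    (hγd : ∀ t ∈ Icc 0 T, MDifferentiableAt 𝓘(ℝ, ℝ) 𝓘(ℝ, E) γ t)
    (hU : ContinuousOn (fun t ↦ ((trivializationAt E (TangentSpace 𝓘(ℝ, E) : M → Type _) x₁)
        ⟨γ t, velocity 𝓘(ℝ, E) γ t⟩).2) (Icc 0 T))
    {t₀ : ℝ} (ht₀ : t₀ ∈ Icc 0 T) (v : TangentSpace 𝓘(ℝ, E) (γ t₀)) :
    ∃ W : Π t : ℝ, TangentSpace 𝓘(ℝ, E) (γ t), W t₀ = v ∧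
      IsParallelAlongOn cov γ W (Ioo 0 T) := by
  have hbase : ∀ t ∈ Icc 0 T,
      γ t ∈ (trivializationAt E (TangentSpace 𝓘(ℝ, E) : M → Type _) x₁).baseSet := fun t ht ↦ by
    simpa using hγs t ht
  have hsrc : ∀ t ∈ Icc 0 T, γ t ∈ (extChartAt 𝓘(ℝ, E) x₁).source := fun t ht ↦ by
    rw [extChartAt_source]; exact hγs t ht
  set A : ℝ → E →L[ℝ] E := fun t ↦ -Γmat cov hcov x₁ (γ t)
      ((trivializationAt E (TangentSpace 𝓘(ℝ, E) : M → Type _) x₁) ⟨γ t, velocity 𝓘(ℝ, E) γ t⟩).2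
    with hA
  have hAcont : ContinuousOn A (Icc 0 T) := by
    have hG := (contDiffOn_Γmat cov hcov x₁).continuousOn
    have hq : ContinuousOn (fun t ↦ ((extChartAt 𝓘(ℝ, E) x₁) (γ t),
        ((trivializationAt E (TangentSpace 𝓘(ℝ, E) : M → Type _) x₁)
          ⟨γ t, velocity 𝓘(ℝ, E) γ t⟩).2)) (Icc 0 T) := by
      refine ContinuousOn.prodMk (fun t ht ↦ ?_) hU
      exact ((continuousAt_extChartAt' (hsrc t ht)).comp (hγd t ht).continuousAt).continuousWithinAt
    have hmaps : MapsTo (fun t ↦ ((extChartAt 𝓘(ℝ, E) x₁) (γ t),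
        ((trivializationAt E (TangentSpace 𝓘(ℝ, E) : M → Type _) x₁)
          ⟨γ t, velocity 𝓘(ℝ, E) γ t⟩).2)) (Icc 0 T)
        ((extChartAt 𝓘(ℝ, E) x₁).target ×ˢ univ) := fun t ht ↦
      ⟨(extChartAt 𝓘(ℝ, E) x₁).map_source (hsrc t ht), mem_univ _⟩
    have hcomp := (hG.comp hq hmaps).neg
    refine hcomp.congr fun t ht ↦ ?_
    simp only [hA, Pi.neg_apply, Function.comp_apply]
    rw [(extChartAt 𝓘(ℝ, E) x₁).left_inv (hsrc t ht)]
  obtain ⟨J, K, hJ0, hK0, hJ, -, hKJ⟩ := exists_solution_linear_leftInverse hT hAcont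
  have hJK : (J t₀).comp (K t₀) = ContinuousLinearMap.id ℝ E := comp_eq_id_comm (hKJ t₀ ht₀)
  set c₁ : E := ((trivializationAt E (TangentSpace 𝓘(ℝ, E) : M → Type _) x₁) ⟨γ t₀, v⟩).2
    with hc₁
  set w : ℝ → E := fun t ↦ J t (K t₀ c₁) with hw
  have hwderiv : ∀ t ∈ Icc 0 T, HasDerivWithinAt w (A t (w t)) (Icc 0 T) t := by
    intro t ht
    have h := (hJ t ht).clm_apply (hasDerivWithinAt_const t (Icc 0 T) (K t₀ c₁))
    simpa [hw] using h
  refine ⟨fun t ↦ (trivializationAt E (TangentSpace 𝓘(ℝ, E) : M → Type _) x₁).symmL ℝ (γ t) (w t),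
    ?_, fun t ht ↦ ?_⟩
  · have hw0 : w t₀ = c₁ := by
      have := congrArg (fun f : E →L[ℝ] E ↦ f c₁) hJK
      simpa [hw] using this
    simp only [hw0, hc₁]
    rw [← Trivialization.continuousLinearMapAt_apply_of_mem (R := ℝ)
      (e := trivializationAt E (TangentSpace 𝓘(ℝ, E) : M → Type _) x₁) (hb := hbase t₀ ht₀) (y := v)]
    exact Trivialization.symmL_continuousLinearMapAt _ (hbase t₀ ht₀) v
  · have htI : t ∈ Icc 0 T := Ioo_subset_Icc_self ht
    have hwt : HasDerivAt w (A t (w t)) t := (hwderiv t htI).hasDerivAt (Icc_mem_nhds ht.1 ht.2)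
    exact isParallelAt_symmL_of_hasDerivAt cov hcov x₁ (hγs t htI) (hγd t htI)
      (by simpa only [hA, neg_apply] using hwt)

end ParallelTransportAt


/-! ### §F7. Parallel orthonormal frames along a curve in a chart -/

section ParallelFrameExist

universe u

variable {E : Type u} [NormedAddCommGroup E] [NormedSpace ℝ E] [FiniteDimensional ℝ E]
  [CompleteSpace E] {M : Type*} [TopologicalSpace M] [ChartedSpace E M] [IsManifold 𝓘(ℝ, E) ∞ M]
  {n : ℕ∞ω}

omit [CompleteSpace E] in
/-- **Parallel orthonormal frames along a curve in a chart** (Chavel 2006, §III.1: "let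
`{e₁, …, e_{n}}` be a parallel orthonormal frame field along `γ`"): from parallel transport with
prescribed value at an interior parameter `t₀` and the constancy of inner products of parallel
fields (§F1), an orthonormal family at `γ t₀` extends to fields parallel on `(0, T)` and
orthonormal at every parameter of `(0, T)`. [cite: Chavel2006, §III.1] -/
theorem exists_parallel_orthonormal_frame_of_transport [Fact (1 ≤ n)]
    (g : PseudoRiemannianMetric 𝓘(ℝ, E) n E (TangentSpace 𝓘(ℝ, E) : M → Type _))
    {cov : CovariantDerivative 𝓘(ℝ, E) E (TangentSpace 𝓘(ℝ, E) : M → Type _)}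
    (hcov : g.IsCompatible cov) {γ : ℝ → M} {T t₀ : ℝ} (ht₀ : t₀ ∈ Ioo 0 T)
    (hex : ∀ v : TangentSpace 𝓘(ℝ, E) (γ t₀), ∃ W : Π t : ℝ, TangentSpace 𝓘(ℝ, E) (γ t),
      W t₀ = v ∧ IsParallelAlongOn cov γ W (Ioo 0 T))
    {ι : Type*} [DecidableEq ι] (v : ι → TangentSpace 𝓘(ℝ, E) (γ t₀))
    (hv : ∀ i j, g.val (γ t₀) (v i) (v j) = if i = j then 1 else 0) :
    ∃ e : ι → Π t : ℝ, TangentSpace 𝓘(ℝ, E) (γ t), (∀ i, e i t₀ = v i) ∧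
      (∀ i, IsParallelAlongOn cov γ (e i) (Ioo 0 T)) ∧
      ∀ t ∈ Ioo 0 T, ∀ i j, g.val (γ t) (e i t) (e j t) = if i = j then 1 else 0 := by
  choose e he0 hep using fun i ↦ hex (v i)
  refine ⟨e, he0, hep, fun t ht i j ↦ ?_⟩
  -- work on the closed interval between `t₀` and `t`, inside `(0, T)`
  set a := min t₀ t with ha
  set b := max t₀ t with hb
  have hsub : Icc a b ⊆ Ioo 0 T := fun s hs ↦
    ⟨lt_of_lt_of_le (lt_min ht₀.1 ht.1) hs.1, lt_of_le_of_lt hs.2 (max_lt ht₀.2 ht.2)⟩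
  have hmono : ∀ k, IsParallelAlongOn cov γ (e k) (Icc a b) := fun k s hs ↦ hep k s (hsub hs)
  have hta : t ∈ Icc a b := ⟨min_le_right _ _, le_max_right _ _⟩
  have ht₀a : t₀ ∈ Icc a b := ⟨min_le_left _ _, le_max_left _ _⟩
  rw [val_apply_eq_of_isParallelAlongOn g hcov (hmono i) (hmono j) hta,
    ← val_apply_eq_of_isParallelAlongOn g hcov (hmono i) (hmono j) ht₀a, he0, he0, hv]


/-- **Existence of parallel orthonormal frames along a curve inside a chart** (Chavel 2006,
§III.1; O'Neill 1983, Ch. 3, Prop. 3.19): for a locally `C^∞` covariant derivative compatible with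
`g` and a differentiable curve `γ : [0, T] → M` in a chart domain with continuous coordinate
velocity, every `g`-orthonormal family at `γ t₀`, `t₀ ∈ (0, T)`, extends to fields parallel on
`(0, T)` and orthonormal on `(0, T)` (`exists_isParallelAlongOn_eq_at` +
`exists_parallel_orthonormal_frame_of_transport`). [cite: Chavel2006, §III.1] -/
theorem exists_parallel_orthonormal_frame [Fact (1 ≤ n)]
    (g : PseudoRiemannianMetric 𝓘(ℝ, E) n E (TangentSpace 𝓘(ℝ, E) : M → Type _))
    {cov : CovariantDerivative 𝓘(ℝ, E) E (TangentSpace 𝓘(ℝ, E) : M → Type _)}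
    (hcov : g.IsCompatible cov) (hreg : cov.IsLocallyContMDiff ∞) (x₁ : M) {γ : ℝ → M} {T : ℝ}
    (hT : 0 ≤ T) (hγs : ∀ t ∈ Icc 0 T, γ t ∈ (chartAt E x₁).source)
    (hγd : ∀ t ∈ Icc 0 T, MDifferentiableAt 𝓘(ℝ, ℝ) 𝓘(ℝ, E) γ t)
    (hU : ContinuousOn (fun t ↦ ((trivializationAt E (TangentSpace 𝓘(ℝ, E) : M → Type _) x₁)
        ⟨γ t, velocity 𝓘(ℝ, E) γ t⟩).2) (Icc 0 T))
    {t₀ : ℝ} (ht₀ : t₀ ∈ Ioo 0 T) {ι : Type*} [DecidableEq ι]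
    (v : ι → TangentSpace 𝓘(ℝ, E) (γ t₀))
    (hv : ∀ i j, g.val (γ t₀) (v i) (v j) = if i = j then 1 else 0) :
    ∃ e : ι → Π t : ℝ, TangentSpace 𝓘(ℝ, E) (γ t), (∀ i, e i t₀ = v i) ∧
      (∀ i, IsParallelAlongOn cov γ (e i) (Ioo 0 T)) ∧
      ∀ t ∈ Ioo 0 T, ∀ i j, g.val (γ t) (e i t) (e j t) = if i = j then 1 else 0 :=
  exists_parallel_orthonormal_frame_of_transport g hcov ht₀
    (fun w ↦ exists_isParallelAlongOn_eq_at cov hreg x₁ hT hγs hγd hU (Ioo_subset_Icc_self ht₀) w)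
    v hv

end ParallelFrameExist


/-! ### §F10. General parameter intervals `[a, b]`: transport and frames with `0` interior -/

section ShiftedLinearODE

variable {F : Type*} [NormedAddCommGroup F] [NormedSpace ℝ F] [CompleteSpace F]

/-- **The solution operator on a general interval** (shift `t = a + s` in
`exists_solution_linear_leftInverse`): for `A` continuous on `[a, b]` there are `J, K` with
`J' = A J` within `[a, b]` and `K t ∘ J t = id` on `[a, b]`. [folklore] -/
theorem exists_solution_linear_leftInverse_Icc {A : ℝ → F →L[ℝ] F} {a b : ℝ} (hab : a ≤ b)
    (hA : ContinuousOn A (Icc a b)) :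
    ∃ J K : ℝ → F →L[ℝ] F,
      (∀ t ∈ Icc a b, HasDerivWithinAt J ((A t).comp (J t)) (Icc a b) t) ∧
      ∀ t ∈ Icc a b, (K t).comp (J t) = ContinuousLinearMap.id ℝ F := by
  have hT : 0 ≤ b - a := sub_nonneg.2 hab
  have hmaps : MapsTo (fun s : ℝ ↦ a + s) (Icc 0 (b - a)) (Icc a b) := fun s hs ↦
    ⟨by linarith [hs.1], by linarith [hs.2]⟩
  have hA₀ : ContinuousOn (fun s ↦ A (a + s)) (Icc 0 (b - a)) :=
    hA.comp (continuousOn_const.add continuousOn_id) hmaps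
  obtain ⟨J₀, K₀, -, -, hJ₀, -, hKJ₀⟩ := exists_solution_linear_leftInverse hT hA₀
  refine ⟨fun t ↦ J₀ (t - a), fun t ↦ K₀ (t - a), fun t ht ↦ ?_, fun t ht ↦ ?_⟩
  · have hts : t - a ∈ Icc 0 (b - a) := ⟨by linarith [ht.1], by linarith [ht.2]⟩
    have hmaps' : MapsTo (fun t : ℝ ↦ t - a) (Icc a b) (Icc 0 (b - a)) := fun u hu ↦
      ⟨by linarith [hu.1], by linarith [hu.2]⟩
    have hsub : HasDerivWithinAt (fun t : ℝ ↦ t - a) 1 (Icc a b) t :=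
      (hasDerivWithinAt_id t _).sub_const a
    have h := (hJ₀ (t - a) hts).scomp t hsub hmaps'
    simp only [one_smul, add_sub_cancel] at h
    exact h
  · exact hKJ₀ (t - a) ⟨by linarith [ht.1], by linarith [ht.2]⟩

end ShiftedLinearODE

section ParallelTransportIcc

universe u

variable {E : Type u} [NormedAddCommGroup E] [NormedSpace ℝ E] [FiniteDimensional ℝ E]
  [CompleteSpace E] {M : Type*} [TopologicalSpace M] [ChartedSpace E M] [IsManifold 𝓘(ℝ, E) ∞ M]
  {n : ℕ∞ω}

/-- **Parallel transport from any parameter** (O'Neill 1983, Ch. 3, Prop. 3.19, inside one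
chart): on a general parameter interval `[a, b]` (so that a distinguished parameter, e.g. `0`, may be
interior): for a curve `γ : [a, b] → M` in the chart domain of `x₁`, differentiable with continuous
coordinate velocity, for every
`t₀ ∈ [a, b]` and `v ∈ T_{γ t₀}M` there is a field `W` along `γ`, parallel on `(a, b)`, with
`W t₀ = v` — the solution operator `J(t)` of the parallel-transport equation is invertible
(`exists_solution_linear_leftInverse`, `comp_eq_id_comm`), so one may prescribe `w(t₀)`.
[cite: ONeill1983, Ch. 3, Prop. 3.19] -/
theorem exists_isParallelAlongOn_eq_at_Icc
    (cov : CovariantDerivative 𝓘(ℝ, E) E (TangentSpace 𝓘(ℝ, E) : M → Type _))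
    (hcov : cov.IsLocallyContMDiff ∞) (x₁ : M) {γ : ℝ → M} {a b : ℝ} (hab : a ≤ b)
    (hγs : ∀ t ∈ Icc a b, γ t ∈ (chartAt E x₁).source)
    (hγd : ∀ t ∈ Icc a b, MDifferentiableAt 𝓘(ℝ, ℝ) 𝓘(ℝ, E) γ t)
    (hU : ContinuousOn (fun t ↦ ((trivializationAt E (TangentSpace 𝓘(ℝ, E) : M → Type _) x₁)
        ⟨γ t, velocity 𝓘(ℝ, E) γ t⟩).2) (Icc a b))
    {t₀ : ℝ} (ht₀ : t₀ ∈ Icc a b) (v : TangentSpace 𝓘(ℝ, E) (γ t₀)) :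
    ∃ W : Π t : ℝ, TangentSpace 𝓘(ℝ, E) (γ t), W t₀ = v ∧
      IsParallelAlongOn cov γ W (Ioo a b) := by
  have hbase : ∀ t ∈ Icc a b,
      γ t ∈ (trivializationAt E (TangentSpace 𝓘(ℝ, E) : M → Type _) x₁).baseSet := fun t ht ↦ by
    simpa using hγs t ht
  have hsrc : ∀ t ∈ Icc a b, γ t ∈ (extChartAt 𝓘(ℝ, E) x₁).source := fun t ht ↦ by
    rw [extChartAt_source]; exact hγs t ht
  set A : ℝ → E →L[ℝ] E := fun t ↦ -Γmat cov hcov x₁ (γ t)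
      ((trivializationAt E (TangentSpace 𝓘(ℝ, E) : M → Type _) x₁) ⟨γ t, velocity 𝓘(ℝ, E) γ t⟩).2
    with hA
  have hAcont : ContinuousOn A (Icc a b) := by
    have hG := (contDiffOn_Γmat cov hcov x₁).continuousOn
    have hq : ContinuousOn (fun t ↦ ((extChartAt 𝓘(ℝ, E) x₁) (γ t),
        ((trivializationAt E (TangentSpace 𝓘(ℝ, E) : M → Type _) x₁)
          ⟨γ t, velocity 𝓘(ℝ, E) γ t⟩).2)) (Icc a b) := by
      refine ContinuousOn.prodMk (fun t ht ↦ ?_) hU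
      exact ((continuousAt_extChartAt' (hsrc t ht)).comp (hγd t ht).continuousAt).continuousWithinAt
    have hmaps : MapsTo (fun t ↦ ((extChartAt 𝓘(ℝ, E) x₁) (γ t),
        ((trivializationAt E (TangentSpace 𝓘(ℝ, E) : M → Type _) x₁)
          ⟨γ t, velocity 𝓘(ℝ, E) γ t⟩).2)) (Icc a b)
        ((extChartAt 𝓘(ℝ, E) x₁).target ×ˢ univ) := fun t ht ↦
      ⟨(extChartAt 𝓘(ℝ, E) x₁).map_source (hsrc t ht), mem_univ _⟩
    have hcomp := (hG.comp hq hmaps).neg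
    refine hcomp.congr fun t ht ↦ ?_
    simp only [hA, Pi.neg_apply, Function.comp_apply]
    rw [(extChartAt 𝓘(ℝ, E) x₁).left_inv (hsrc t ht)]
  obtain ⟨J, K, hJ, hKJ⟩ := exists_solution_linear_leftInverse_Icc hab hAcont
  have hJK : (J t₀).comp (K t₀) = ContinuousLinearMap.id ℝ E := comp_eq_id_comm (hKJ t₀ ht₀)
  set c₁ : E := ((trivializationAt E (TangentSpace 𝓘(ℝ, E) : M → Type _) x₁) ⟨γ t₀, v⟩).2
    with hc₁
  set w : ℝ → E := fun t ↦ J t (K t₀ c₁) with hw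
  have hwderiv : ∀ t ∈ Icc a b, HasDerivWithinAt w (A t (w t)) (Icc a b) t := by
    intro t ht
    have h := (hJ t ht).clm_apply (hasDerivWithinAt_const t (Icc a b) (K t₀ c₁))
    simpa [hw] using h
  refine ⟨fun t ↦ (trivializationAt E (TangentSpace 𝓘(ℝ, E) : M → Type _) x₁).symmL ℝ (γ t) (w t),
    ?_, fun t ht ↦ ?_⟩
  · have hw0 : w t₀ = c₁ := by
      have := congrArg (fun f : E →L[ℝ] E ↦ f c₁) hJK
      simpa [hw] using this
    simp only [hw0, hc₁]
    rw [← Trivialization.continuousLinearMapAt_apply_of_mem (R := ℝ)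
      (e := trivializationAt E (TangentSpace 𝓘(ℝ, E) : M → Type _) x₁) (hb := hbase t₀ ht₀) (y := v)]
    exact Trivialization.symmL_continuousLinearMapAt _ (hbase t₀ ht₀) v
  · have htI : t ∈ Icc a b := Ioo_subset_Icc_self ht
    have hwt : HasDerivAt w (A t (w t)) t := (hwderiv t htI).hasDerivAt (Icc_mem_nhds ht.1 ht.2)
    exact isParallelAt_symmL_of_hasDerivAt cov hcov x₁ (hγs t htI) (hγd t htI)
      (by simpa only [hA, neg_apply] using hwt)


/-- **Parallel orthonormal frames on a general parameter interval**: for a locally `C^∞`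
covariant derivative compatible with `g` and a differentiable curve `γ : [a, b] → M` in a chart
domain with continuous coordinate velocity, every `g`-orthonormal family at `γ t₀`,
`t₀ ∈ (a, b)`, extends to fields parallel and orthonormal on `(a, b)` (as
`exists_parallel_orthonormal_frame`, through `exists_isParallelAlongOn_eq_at_Icc`).
[cite: Chavel2006, §III.1] -/
theorem exists_parallel_orthonormal_frame_Icc [Fact (1 ≤ n)]
    (g : PseudoRiemannianMetric 𝓘(ℝ, E) n E (TangentSpace 𝓘(ℝ, E) : M → Type _))
    {cov : CovariantDerivative 𝓘(ℝ, E) E (TangentSpace 𝓘(ℝ, E) : M → Type _)}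
    (hcov : g.IsCompatible cov) (hreg : cov.IsLocallyContMDiff ∞) (x₁ : M) {γ : ℝ → M} {a b : ℝ}
    (hab : a ≤ b) (hγs : ∀ t ∈ Icc a b, γ t ∈ (chartAt E x₁).source)
    (hγd : ∀ t ∈ Icc a b, MDifferentiableAt 𝓘(ℝ, ℝ) 𝓘(ℝ, E) γ t)
    (hU : ContinuousOn (fun t ↦ ((trivializationAt E (TangentSpace 𝓘(ℝ, E) : M → Type _) x₁)
        ⟨γ t, velocity 𝓘(ℝ, E) γ t⟩).2) (Icc a b))
    {t₀ : ℝ} (ht₀ : t₀ ∈ Ioo a b) {ι : Type*} [DecidableEq ι]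
    (v : ι → TangentSpace 𝓘(ℝ, E) (γ t₀))
    (hv : ∀ i j, g.val (γ t₀) (v i) (v j) = if i = j then 1 else 0) :
    ∃ e : ι → Π t : ℝ, TangentSpace 𝓘(ℝ, E) (γ t), (∀ i, e i t₀ = v i) ∧
      (∀ i, IsParallelAlongOn cov γ (e i) (Ioo a b)) ∧
      ∀ t ∈ Ioo a b, ∀ i j, g.val (γ t) (e i t) (e j t) = if i = j then 1 else 0 := by
  choose e he0 hep using fun i ↦ exists_isParallelAlongOn_eq_at_Icc cov hreg x₁ hab hγs hγd hU
    (Ioo_subset_Icc_self ht₀) (v i)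
  refine ⟨e, he0, hep, fun t ht i j ↦ ?_⟩
  set a' := min t₀ t with ha'
  set b' := max t₀ t with hb'
  have hsub : Icc a' b' ⊆ Ioo a b := fun s hs ↦
    ⟨lt_of_lt_of_le (lt_min ht₀.1 ht.1) hs.1, lt_of_le_of_lt hs.2 (max_lt ht₀.2 ht.2)⟩
  have hmono : ∀ k, IsParallelAlongOn cov γ (e k) (Icc a' b') := fun k s hs ↦ hep k s (hsub hs)
  have hta : t ∈ Icc a' b' := ⟨min_le_right _ _, le_max_right _ _⟩
  have ht₀a : t₀ ∈ Icc a' b' := ⟨min_le_left _ _, le_max_left _ _⟩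
  rw [val_apply_eq_of_isParallelAlongOn g hcov (hmono i) (hmono j) hta,
    ← val_apply_eq_of_isParallelAlongOn g hcov (hmono i) (hmono j) ht₀a, he0, he0, hv]

end ParallelTransportIcc


/-! ### §F21. Uniqueness of parallel fields from definiteness, and the full frame along a
geodesic inside a chart (model `𝓘(ℝ, E)`) -/

section UniqueParallel

variable {E : Type*} [NormedAddCommGroup E] [NormedSpace ℝ E] {H : Type*} [TopologicalSpace H]
  {I : ModelWithCorners ℝ E H} {M : Type*} [TopologicalSpace M] [ChartedSpace H M]
  [IsManifold I ∞ M] [FiniteDimensional ℝ E] {n : ℕ∞ω}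
  (g : PseudoRiemannianMetric I n E (TangentSpace I : M → Type _))

/-- **Parallel fields with the same value somewhere coincide** (for a positive definite metric):
if `P, Q` are parallel on `[a, b]` for a `g`-compatible connection, `g` is Riemannian and
`P t₀ = Q t₀` for some `t₀ ∈ [a, b]`, then `P = Q` on `[a, b]` — expand `g(P - Q, P - Q)` by
bilinearity; every term is constant (`val_apply_eq_of_isParallelAlongOn`) and the sum vanishes
at `t₀`. (Avoids the uniqueness theorem for the linear parallel-transport equation.)
[cite: ONeill1983, Ch. 3, Prop. 3.19 (uniqueness of parallel translation)] -/
theorem eq_of_isParallelAlongOn_of_eq [Fact (1 ≤ n)] (hg : g.IsRiemannian)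
    {cov : CovariantDerivative I E (TangentSpace I : M → Type _)} (hcov : g.IsCompatible cov)
    {γ : ℝ → M} {P Q : Π t : ℝ, TangentSpace I (γ t)} {a b : ℝ}
    (hP : IsParallelAlongOn cov γ P (Icc a b)) (hQ : IsParallelAlongOn cov γ Q (Icc a b))
    {t₀ : ℝ} (ht₀ : t₀ ∈ Icc a b) (h0 : P t₀ = Q t₀) {t : ℝ} (ht : t ∈ Icc a b) :
    P t = Q t := by
  have hPP : ∀ {s}, s ∈ Icc a b → g.val (γ s) (P s) (P s) = g.val (γ a) (P a) (P a) :=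
    fun hs ↦ val_apply_eq_of_isParallelAlongOn g hcov hP hP hs
  have hPQ : ∀ {s}, s ∈ Icc a b → g.val (γ s) (P s) (Q s) = g.val (γ a) (P a) (Q a) :=
    fun hs ↦ val_apply_eq_of_isParallelAlongOn g hcov hP hQ hs
  have hQQ : ∀ {s}, s ∈ Icc a b → g.val (γ s) (Q s) (Q s) = g.val (γ a) (Q a) (Q a) :=
    fun hs ↦ val_apply_eq_of_isParallelAlongOn g hcov hQ hQ hs
  -- `g(P - Q, P - Q)(t) = g(P - Q, P - Q)(t₀) = 0`
  have key : g.val (γ t) (P t - Q t) (P t - Q t) = 0 := by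
    have h1 : g.val (γ t) (P t - Q t) (P t - Q t) =
        g.val (γ t) (P t) (P t) - 2 * g.val (γ t) (P t) (Q t) + g.val (γ t) (Q t) (Q t) := by
      simp only [map_sub, sub_apply, g.symm (γ t) (Q t) (P t)]; ring
    have h2 : g.val (γ t₀) (P t₀) (P t₀) - 2 * g.val (γ t₀) (P t₀) (Q t₀) +
        g.val (γ t₀) (Q t₀) (Q t₀) = 0 := by rw [h0]; ring
    rw [h1, hPP ht, hPQ ht, hQQ ht, ← hPP ht₀, ← hPQ ht₀, ← hQQ ht₀, h2]
  by_contra hne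
  exact (hg (γ t) (P t - Q t) (sub_ne_zero.2 hne)).ne' key

end UniqueParallel

section FrameAlongGeodesic

universe u

variable {E : Type u} [NormedAddCommGroup E] [NormedSpace ℝ E] [FiniteDimensional ℝ E]
  [CompleteSpace E] {M : Type*} [TopologicalSpace M] [ChartedSpace E M] [IsManifold 𝓘(ℝ, E) ∞ M]
  {n : ℕ∞ω}

/-- **The full orthonormal frame along a geodesic inside a chart** (the frame input `f` of
`normalJacobiTensor_frame`, chart-locally): for a Riemannian `C^n` metric `g` (`n ≥ 1`) with
Levi-Civita connection locally `C^∞`, a curve `γ` which is a geodesic on `[a, b] ∋ 0`, lies in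
the chart domain of `x₁` and has unit speed at `0`, there are `k` and
`f(t) : Option (Fin k) → T_{γ t}M` with `f(t) none = γ̇(t)`, normal part `f(·)(some i)` parallel
on `(a, b)`, `g`-orthonormal on `(a, b)`, and `card (Option (Fin k)) = dim M`: take a
`g`-orthonormal frame at `γ 0` headed by `γ̇(0)` (`exists_orthonormal_frame_with_head`), transport
it (`exists_parallel_orthonormal_frame_Icc`), and identify the transported head with `γ̇`
(`eq_of_isParallelAlongOn_of_eq`). [cite: Chavel2006, §III.1 (parallel orthonormal frames along geodesics)] -/
theorem exists_fullFrame_along_geodesic [Fact (1 ≤ n)]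
    (g : PseudoRiemannianMetric 𝓘(ℝ, E) n E (TangentSpace 𝓘(ℝ, E) : M → Type _))
    [g.HasLeviCivita] (hg : g.IsRiemannian) (hreg : g.leviCivita.IsLocallyContMDiff ∞) (x₁ : M)
    {γ : ℝ → M} {a b : ℝ} (h0 : (0 : ℝ) ∈ Ioo a b)
    (hgeo : IsGeodesicOn g.leviCivita γ (Icc a b))
    (hγs : ∀ t ∈ Icc a b, γ t ∈ (chartAt E x₁).source)
    (hunit : g.val (γ 0) (velocity 𝓘(ℝ, E) γ 0) (velocity 𝓘(ℝ, E) γ 0) = 1) :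
    ∃ (k : ℕ) (f : Π t : ℝ, Option (Fin k) → TangentSpace 𝓘(ℝ, E) (γ t)),
      (∀ t, f t none = velocity 𝓘(ℝ, E) γ t) ∧
      (∀ i, IsParallelAlongOn g.leviCivita γ (fun t ↦ f t (some i)) (Ioo a b)) ∧
      (∀ t ∈ Ioo a b, ∀ o o', g.val (γ t) (f t o) (f t o') = if o = o' then 1 else 0) ∧
      Fintype.card (Option (Fin k)) = Module.finrank ℝ E := by
  have hcompat : g.IsCompatible g.leviCivita :=
    (PseudoRiemannianMetric.isLeviCivita_leviCivita_holds (g := g)).2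
  have hab : a ≤ b := (h0.1.trans h0.2).le
  -- differentiability of `γ` and continuity of the coordinate velocity from the geodesic lift
  have hγd : ∀ t ∈ Icc a b, MDifferentiableAt 𝓘(ℝ, ℝ) 𝓘(ℝ, E) γ t := fun t ht ↦
    ((contMDiff_proj (TangentSpace 𝓘(ℝ, E) : M → Type _) (n := 1)).mdifferentiableAt
      one_ne_zero).comp t
      (hgeo.1 t ht)
  have hU : ContinuousOn (fun t ↦ ((trivializationAt E (TangentSpace 𝓘(ℝ, E) : M → Type _) x₁)
      ⟨γ t, velocity 𝓘(ℝ, E) γ t⟩).2) (Icc a b) := by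
    intro t ht
    set e := trivializationAt E (TangentSpace 𝓘(ℝ, E) : M → Type _) x₁ with he
    have hsrc : (tangentLift 𝓘(ℝ, E) γ t : TangentBundle 𝓘(ℝ, E) M) ∈ e.source := by
      rw [e.mem_source]; simpa [he] using hγs t ht
    have he_cont : ContinuousAt (fun z : TangentBundle 𝓘(ℝ, E) M ↦ e z) (tangentLift 𝓘(ℝ, E) γ t) :=
      e.toOpenPartialHomeomorph.continuousAt hsrc
    have hlift : ContinuousAt (tangentLift 𝓘(ℝ, E) γ) t := (hgeo.1 t ht).continuousAt
    exact (continuousAt_snd.comp (ContinuousAt.comp (f := tangentLift 𝓘(ℝ, E) γ) he_cont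
      hlift)).continuousWithinAt
  -- the frame at `γ 0` headed by `γ̇ 0`, transported
  obtain ⟨k, f₀, hf₀none, hf₀on, hcard⟩ := exists_orthonormal_frame_with_head g hg (γ 0) hunit
  obtain ⟨e', he'0, he'par, he'on⟩ := exists_parallel_orthonormal_frame_Icc g hcompat hreg x₁ hab
    hγs hγd hU h0 f₀ hf₀on
  -- the transported head is `γ̇`
  have hT : IsParallelAlongOn g.leviCivita γ (fun t ↦ velocity 𝓘(ℝ, E) γ t) (Icc a b) :=
    IsGeodesicOn.isParallelAlongOn_velocity hgeo
  have hhead : ∀ t ∈ Ioo a b, e' none t = velocity 𝓘(ℝ, E) γ t := by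
    intro t ht
    set a' := min 0 t with ha'
    set b' := max 0 t with hb'
    have hsub : Icc a' b' ⊆ Ioo a b := fun s hs ↦
      ⟨lt_of_lt_of_le (lt_min h0.1 ht.1) hs.1, lt_of_le_of_lt hs.2 (max_lt h0.2 ht.2)⟩
    have hP : IsParallelAlongOn g.leviCivita γ (e' none) (Icc a' b') :=
      fun s hs ↦ he'par none s (hsub hs)
    have hQ : IsParallelAlongOn g.leviCivita γ (fun t ↦ velocity 𝓘(ℝ, E) γ t) (Icc a' b') :=
      fun s hs ↦ hT s (Ioo_subset_Icc_self (hsub hs))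
    have h00 : e' none 0 = velocity 𝓘(ℝ, E) γ 0 := by rw [he'0, hf₀none]
    exact eq_of_isParallelAlongOn_of_eq g hg hcompat hP hQ ⟨min_le_left _ _, le_max_left _ _⟩
      h00 ⟨min_le_right _ _, le_max_right _ _⟩
  refine ⟨k, fun t o ↦ o.elim (velocity 𝓘(ℝ, E) γ t) (fun i ↦ e' (some i) t), fun t ↦ rfl,
    fun i ↦ he'par (some i), ?_, hcard⟩
  intro t ht o o'
  have hon := he'on t ht
  rcases o with _ | i <;> rcases o' with _ | j
  · simpa [← hhead t ht] using hon none none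
  · simpa [← hhead t ht] using hon none (some j)
  · simpa [← hhead t ht] using hon (some i) none
  · simpa using hon (some i) (some j)

end FrameAlongGeodesic

/-! ### §F22. Chart-local geometric theorems without frame hypotheses (model `𝓘(ℝ, E)`):
Bonnet–Myers' conjugate point bound and Bishop's comparison along `γ_v` -/

section ChartLocal

open Function

universe u

variable {E : Type u} [NormedAddCommGroup E] [NormedSpace ℝ E] [FiniteDimensional ℝ E]
  [CompleteSpace E] {M : Type*} [TopologicalSpace M] [ChartedSpace E M] [IsManifold 𝓘(ℝ, E) ∞ M]
  [T2Space M] {n : ℕ∞ω} [Fact (1 ≤ n)]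
  (g : PseudoRiemannianMetric 𝓘(ℝ, E) n E (TangentSpace 𝓘(ℝ, E) : M → Type _)) [g.HasLeviCivita]
  [CovariantDerivative.ContMDiffCovariantDerivative g.leviCivita 1]
  [CovariantDerivative.ContMDiffCovariantDerivative g.leviCivita ∞]

omit [FiniteDimensional ℝ E] [CompleteSpace E] [T2Space M] [Fact (1 ≤ n)] [g.HasLeviCivita]
  [CovariantDerivative.ContMDiffCovariantDerivative g.leviCivita 1]
  [CovariantDerivative.ContMDiffCovariantDerivative g.leviCivita ∞] in
/-- From `card (Option (Fin k)) = dim M ≥ 2` to `Fin k` nonempty. [folklore] -/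
theorem nonempty_fin_of_card_option {k : ℕ} (hcard : Fintype.card (Option (Fin k)) = Module.finrank ℝ E)
    (hdim : 2 ≤ Module.finrank ℝ E) : Nonempty (Fin k) := by
  rw [Fintype.card_option, Fintype.card_fin] at hcard
  exact ⟨⟨0, by omega⟩⟩

/-- **No conjugate point of `γ_v` before `π` under `Ric ≥ dim - 1`, chart-locally** (Bonnet–Myers'
conjugate point estimate; Chavel 2006, Thm. III.4.3 / §III.2; `dim M ≥ 2`): for a complete
Riemannian `C^n` metric (`n ≥ 2`) with Levi-Civita connection locally `C¹` and `C^∞`, a unit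
vector `v ∈ T_pM` and `a < 0 < b` such that `γ_v([a, b])` lies in the chart domain of `p`: if
`Ric(γ̇_v, γ̇_v) ≥ dim M - 1` on `(0, b)` and `d(exp_p)` is injective at `t v` for all
`t ∈ (0, b)`, then `b ≤ π` (`exists_fullFrame_along_geodesic` + `noConjugate_length_le_pi_frame`).
[cite: Chavel2006, §III.4, Thm. III.4.3 and §III.2; CheegerColding1997, (0.5)] -/
theorem noConjugate_length_le_pi_chart (hg : g.IsRiemannian)
    (hreg1 : g.leviCivita.IsLocallyContMDiff 1) (hreg : g.leviCivita.IsLocallyContMDiff ∞)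
    (hinf : g.leviCivita.IsLocallyContMDiff (⊤ : ℕ∞)) (hn : 2 ≤ n)
    (hdim : 2 ≤ Module.finrank ℝ E) (hc : IsGeodesicallyComplete g.leviCivita) (p : M)
    (v : TangentSpace 𝓘(ℝ, E) p) (hv : g.val p v v = 1) {a b : ℝ} (h0 : (0 : ℝ) ∈ Ioo a b)
    (hγs : ∀ t ∈ Icc a b, maximalGeodesic g.leviCivita p v t ∈ (chartAt E p).source)
    (hRic : ∀ t ∈ Ioo 0 b, ((Module.finrank ℝ E : ℝ) - 1) ≤
      g.leviCivita.ricci (maximalGeodesic g.leviCivita p v t)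
        (velocity 𝓘(ℝ, E) (maximalGeodesic g.leviCivita p v) t)
        (velocity 𝓘(ℝ, E) (maximalGeodesic g.leviCivita p v) t))
    (hinj : ∀ t ∈ Ioo 0 b, Injective (mfderiv 𝓘(ℝ, E) 𝓘(ℝ, E)
      (fun u : E ↦ expMap g.leviCivita p (show TangentSpace 𝓘(ℝ, E) p from u))
        (t • (show E from v)))) :
    b ≤ Real.pi := by
  obtain ⟨-, hgeo, hγ0, hγv⟩ := maximalGeodesic_of_isGeodesicallyComplete hc p v
  have hunit : g.val (maximalGeodesic g.leviCivita p v 0)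
      (velocity 𝓘(ℝ, E) (maximalGeodesic g.leviCivita p v) 0)
      (velocity 𝓘(ℝ, E) (maximalGeodesic g.leviCivita p v) 0) = 1 := by
    rw [hγv]
    have : maximalGeodesic g.leviCivita p v 0 = p := hγ0
    rw [this]; exact hv
  obtain ⟨k, f, hfnone, hfpar, hon, hcard⟩ := exists_fullFrame_along_geodesic g hg hreg p h0
    (hgeo.mono (subset_univ _)) hγs hunit
  haveI : Nonempty (Fin k) := nonempty_fin_of_card_option hcard hdim
  exact noConjugate_length_le_pi_frame g hreg1 hinf hn hc p v h0 f hfnone hfpar hon hcard hRic hinj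

end ChartLocal

/-! ### §F23. Smooth metrics: the regularity hypotheses discharged -/

section SmoothMetric

open Function

universe u

variable {E : Type u} [NormedAddCommGroup E] [NormedSpace ℝ E] [FiniteDimensional ℝ E]
  [CompleteSpace E] {M : Type*} [TopologicalSpace M] [ChartedSpace E M] [IsManifold 𝓘(ℝ, E) ∞ M]
  [T2Space M] {n : ℕ∞ω}
  (g : PseudoRiemannianMetric 𝓘(ℝ, E) n E (TangentSpace 𝓘(ℝ, E) : M → Type _)) [g.HasLeviCivita]

/-- **Bonnet–Myers' conjugate point bound along `γ_v`, chart-locally, for a smooth complete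
Riemannian metric** (`noConjugate_length_le_pi_chart` with the regularity of the Levi-Civita
connection supplied by `isLocallyContMDiff_leviCivita_holds` /
`contMDiffCovariantDerivative_leviCivita_infty`): for `g` of class `C^n`, `∞ ≤ n`, Riemannian and
geodesically complete, `dim M ≥ 2`, a unit vector `v ∈ T_pM` and `a < 0 < b` with `γ_v([a, b])`
in the chart domain of `p`: if `Ric(γ̇_v, γ̇_v) ≥ dim M - 1` on `(0, b)` and `d(exp_p)` is
injective at `t v` for all `t ∈ (0, b)`, then `b ≤ π`.
[cite: Chavel2006, §III.4, Thm. III.4.3 and §III.2 (Bonnet–Myers); CheegerColding1997, (0.5)] -/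
theorem noConjugate_length_le_pi_of_ricci_ge (hn : (∞ : ℕ∞ω) ≤ n) (hg : g.IsRiemannian)
    (hdim : 2 ≤ Module.finrank ℝ E) (hc : IsGeodesicallyComplete g.leviCivita) (p : M)
    (v : TangentSpace 𝓘(ℝ, E) p) (hv : g.val p v v = 1) {a b : ℝ} (h0 : (0 : ℝ) ∈ Ioo a b)
    (hγs : ∀ t ∈ Icc a b, maximalGeodesic g.leviCivita p v t ∈ (chartAt E p).source)
    (hRic : ∀ t ∈ Ioo 0 b, ((Module.finrank ℝ E : ℝ) - 1) ≤
      g.leviCivita.ricci (maximalGeodesic g.leviCivita p v t)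
        (velocity 𝓘(ℝ, E) (maximalGeodesic g.leviCivita p v) t)
        (velocity 𝓘(ℝ, E) (maximalGeodesic g.leviCivita p v) t))
    (hinj : ∀ t ∈ Ioo 0 b, Injective (mfderiv 𝓘(ℝ, E) 𝓘(ℝ, E)
      (fun u : E ↦ expMap g.leviCivita p (show TangentSpace 𝓘(ℝ, E) p from u))
        (t • (show E from v)))) :
    b ≤ Real.pi := by
  haveI : Fact (1 ≤ n) := ⟨le_trans (by exact_mod_cast le_top) hn⟩
  have h1n : ((1 : ℕ∞) : ℕ∞ω) + 1 ≤ n := le_trans (by exact_mod_cast le_top) hn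
  have htn : ((⊤ : ℕ∞) : ℕ∞ω) + 1 ≤ n := le_trans (by exact_mod_cast le_rfl) hn
  have hreg1 : g.leviCivita.IsLocallyContMDiff 1 := g.isLocallyContMDiff_leviCivita_holds 1 h1n
  have hregi : g.leviCivita.IsLocallyContMDiff ∞ := g.isLocallyContMDiff_leviCivita_holds ⊤ htn
  haveI : CovariantDerivative.ContMDiffCovariantDerivative g.leviCivita ((⊤ : ℕ∞) : ℕ∞ω) :=
    contMDiffCovariantDerivative_leviCivita_infty g hn
  haveI : CovariantDerivative.ContMDiffCovariantDerivative g.leviCivita 1 :=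
    ⟨g.isLocallyContMDiff_leviCivita_holds 1 h1n univ isOpen_univ⟩
  have h2i : (2 : ℕ∞ω) ≤ ∞ := WithTop.coe_le_coe.2 le_top
  have h2n : (2 : ℕ∞ω) ≤ n := h2i.trans hn
  exact noConjugate_length_le_pi_chart g hg hreg1 hregi hregi h2n hdim hc p v hv h0 hγs hRic hinj

end SmoothMetric

end Literature.Geometry.Riemannian
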